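import Summits.AtomisticToContinuum.HydrodynamicLimit.Theses.OneFlightGossipEngine
import Summits.AtomisticToContinuum.HydrodynamicLimit.Theorems.TransferActivityTails.Negative.EquilibriumReduction
import Summits.AtomisticToContinuum.HydrodynamicLimit.Theorems.TransferActivityTails.Negative.ExpMomentFalse

/-!
# Disproof of `EnergyActivityTails` (stmt-AtomisticToContinuum-17703) — findings: NO KILL of the crux (cycle 1);
# the crux is the `L¹` energy half of TwoClocks' 16624, reduces UNCONDITIONALLY to its global-equilibrium rung,
# and its natural LARGE-DEVIATION strengthening is FALSE IN LEAN (new negative lemma, this seat): the Newton-cradle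
# relay of the 13733 refutation is an ENERGY witness — every receiver of the pulse carries energy activity
# `≥ (9/100)t²/l² > V` — so the LD currency of the energy tail dies exactly like the transfer one, while the `L¹`
# crux is untouched (relay weight `e^{−C(N+1)log(tl)}`)

Crux: `Summit.AtomisticToContinuum.HydrodynamicLimit.Theses.OneFlightGossipEngine.EnergyActivityTails`
(route OneFlightGossipEngine, crux #8 = input (iv) of the dock `ClampedTransferDockOfInputs`; the energy twin of
`CollisionActivityTails` 13734; `EAT ∧ CAT ⇔ TwoClocks.TransferActivityTails` 16624, landed both ways).
Standing adversary: refuter-cdisprove-stmt-AtomisticToContinuum-17703-0, cycle 1 (2026-08-17).  Prose lives in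
docstrings; the file is `lean check`ed sorry-free (rc 0, 0 warnings).

LANDING (this cycle, `Theorems/EnergyActivityTails/Negative/`, namespace `Theorems.EnergyActivityTailsNegative`):
`ExpMomentLattice.lean` (p144661 ACCEPTED @42fdd6bdbdf9: `ExpMomentTailsOf F`, `IsEnergyDominating`, pointwise lattice
bounds), `ExpMomentFalse.lean` (p144829: `expMomentTailsOf_false`, `energyActivityTailsExpMoment_false`, the transfer
instance), `ExpMomentHotLattice.lean` (p145161: `IsHotGainDominating W F`, `partnerNormalSpeed`, hot lattice bounds) and
`ExpMomentHotFalse.lean` (p145165: `expMomentTailsOf_false_of_hot`, `hotSupplyExpMoment_false`,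
`hotDonorGainExpMoment_false`).  §3 of THIS file is a byte-identical in-namespace copy (so the workfile certifies itself
before the oleans exist); importers should use the landed names.

INHERITED (read, cited, not re-run; every item generic in the per-record summand applies VERBATIM to this crux through
`TransferActivityTailsNegative.tailsOf_of_le`): the 13734 disprover's `Cruxes/CollisionActivityTails/Disproof.lean`
(two cycles, NO KILL: junk audit; SHAPE `CruxShape ⇒ UIShape` strictly — no moment bound proves the crux, it is a
tagged CONCENTRATION statement in `τ`; load-bearing `V₀ > 0` and `τ → ∞`; equilibrium reduction; UI/fraction split;
hub/platoon budget arithmetic), the 16624 disprover's `Cruxes/TransferActivityTails/Disproof.lean` (§4 energy-specific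
attacks: fast particles, relay, boosts; §5 LD strengthening of the TRANSFER tail refuted = landed
`TransferActivityTailsNegative.transferActivityTailsExpMoment_false`, p127643 — RE-DERIVED below as an instance of the
energy lemma), the route-attack seat rattack-17703 (item evidence `Evidence.lean`/`CRUX-ATTACK-17703.md`: elaboration,
`Iff.rfl` twins ×4, prefix inhabited, Galilean shift, `energyOf ≤ momentumOf·(‖v⁺‖+‖v⁻‖)/2`), the two crux-ideate
sketches (`IdeatorOneSketch`: gain ≤ impulse × PARTNER normal speed, `EAT ⇒ HST(M)`; `IdeatorTwoSketch`: gain/loss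
forms, `EAT ⇒ HDGT(W₀)`, gossip trace identity) and the EDMD toy j022912 (N = 2000/4000, σ³ ∈ {0.05, 0.01}: energy
tail fraction `{A > 3·mean}` = 6.1 % / 1.8 % / 0.27 % / 0.03 % at `L = 2/5/10/20` free times, N-independent —
numerical support FOR the equilibrium rung).

## The statement, read back (`energyActivityTails_iff`, definitional)

For all continuous profiles `a₀ > 0`, `θ₀ > 0`, `u₀`: `∃ σ₀ > 0 ∀ 0 < σ < σ₀`, every horizon `T`, every classical
hs-Euler solution `(ρ,u,θ)` on `[0,T)`, every family of hard-sphere flows `Φ N` (`N+1` spheres of diameter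
`ε_N = σ(N+1)^{-1/3}` on `𝕋³`): IF the local Gibbs laws `λ_N = localGibbsLaw σ a₀ u₀ θ₀ N (Φ N)` satisfy the
hydrodynamic LLN at `t = 0` towards `(ρ,u,θ)(0)`, THEN for every `t ∈ [0,T)`:
`∃ V₀ > 0 ∀ V ≥ V₀ ∀ ε > 0 ∃ τ₀ > 0 ∀ τ ≥ τ₀ ∃ N₀ ∀ N ≥ N₀ ∀ s ∈ [0,t]`,
`E_{λ_N}[(N+1)⁻¹ Σᵢ aᵉᵢ 𝟙{aᵉᵢ > V}] ≤ ε`, `aᵉᵢ = (σ/τ) Σ_{collisions of i with times in (s, s+w]} |‖vᵢ⁺‖² − ‖vᵢ⁻‖²|/2`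
along the orbit of the initial datum, `w = τ(N+1)^{-1/3}` (`= τ/σ` diameters `= τ·√2πσ²·⟨|v_rel|⟩` mean free times).
In words: `lim_{τ→∞} limsup_{N→∞} sup_{s≤t} E[(N+1)⁻¹Σ aᵉᵢ𝟙{aᵉᵢ>V}] = 0` for every `V ≥ V₀(profiles, σ, T, solution, Φ, t)`.

Coercion / junk audit (re-run for the energy summand; all benign, = 16624 §audit): `∫⁻ ∘ ENNReal.ofReal` of a
nonnegative real; `λ_N ≪` Liouville, a probability measure for `σ ≤ 1/2`, the ZERO measure if spheres cannot fit
(then trivially true, never false); `collisionSum` is a `finsum` over the ORBIT's collision records — derived from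
`Φ.flow` on the conull invariant good set, NOT a free field (no junk-flow witness); ordered records, `c.fst = i`
selects one record per collision of `i`; `c.postVel.1 / c.preVel.1` = post/pre velocity of `fst`, and the summand
`|‖v⁺‖²−‖v⁻‖²|/2 = ‖Δvᵢ‖·|⟪(vᵢ+vⱼ)/2, n̂⟫|` exactly (§4): impulse × normal centre-of-mass speed — NOT Galilean
invariant; `T ≤ 0` vacuous; `N₀` after `τ`, `s`-uniformity inside `N₀` (the intended order: `w → 0` at fixed `τ`);
`V₀` after `t` and the whole hypothesis prefix.  The statement ELABORATES (probe rc 0; `Iff.rfl` with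
`TransferActivityTailsNegative.EnergyActivityTails = TailsOf energyOf`).

## Findings (cycle 1)

1. STRUCTURE (§1, checked): crux `= TailsOf energyOf` (`Iff.rfl`); `TwoClocks.TransferActivityTails ⇒ crux`
   (landed `energyActivityTails_of_crux`); `crux ∧ CAT ⇔ 16624`.  Every negative filed against 13734/16624 that is
   generic in the summand is a result about THIS crux.
2. EQUILIBRIUM REDUCTION (§2, checked, UNCONDITIONAL): crux ⇒ `EquilibriumEnergyActivityTails := EquilibriumTailsOf
   energyOf` (constant profiles are hs-Euler states for every `T`, the constant-state LLN is landed) — the `N`-uniform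
   tagged-sphere ENERGY-transfer-activity LLN over `τσ² → ∞` mean free times under the invariant canonical Gibbs law;
   THE refutation target (`not_energyActivityTails_of_not_equilibrium`).  Explicit law, no PDE, no LLN hypothesis.
3. THE NEW NEGATIVE LEMMA (§3, checked, being landed): `EnergyActivityTailsExpMoment` — the exponential-moment (LD)
   strengthening of the equilibrium rung, `∫ exp(β Σᵢ aᵉᵢ𝟙{aᵉᵢ>V}) dG_N ≤ e^{ε(N+1)}` — is FALSE at every `β > 0`, every
   `V`, all large `τ` (`energyActivityTailsExpMoment_false`; more generally `expMomentTailsOf_false` for EVERY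
   nonnegative summand dominating the energy impulse on its own records, `IsEnergyDominating`; TwoClocks' landed
   transfer lemma is the instance `F = transfer`, and the energy statement is the STRONGER negative since
   `ExpMoment(transfer) ⇒ ExpMoment(energy)` by monotonicity).  Witness: the frozen line-lattice Newton-cradle relay
   of the 13733 refutation (`a₀ = θ₀ = 1, u₀ = 0, σ = (4/5)/l², τ = t⁴, N+1 = (ln)³`): every RECEIVER of a pulse
   `c ≥ clo ≍ t³` gets the ENERGY impulse `(‖η + cn‖² − ‖η‖²)/2 ≥ clo(clo−2u)/2 ≥ (9/80)t⁶`, i.e. energy activity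
   `≥ (9/100)t²/l² > V`, receivers are distinct, `≥ (N+1)/6` transfers ⇒ `2Σᵢaᵉᵢ𝟙{aᵉᵢ>V} ≥ Fmin N kw 1 1` and the
   13733 final inequality closes at `β = 2, ε = 1`.  (The landed transfer proof never used the momentum part of
   its summand — that is the observation this seat cashes in.)
   CONSEQUENCE FOR THE DOCK / PROVERS: the energy half of the clamp price (input (iv)) can NOT be obtained at `s > 0`
   from ANY equilibrium statement about this functional through the entropy inequality
   `E_λ[X] ≤ γ⁻¹((N+1)⁻¹H(λ_s|G) + (N+1)⁻¹ log E_G e^{γ(N+1)X})`, `H ≤ κ(N+1)`: that needs `ExpMomentTailsOf energy`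
   at a fixed tilt — false.  The ideator's informal "entropy floor" (IdeatorOneNotes §1 (iii)) is now a theorem for
   the relay family.  A proof of the crux at `s > 0` must propagate an `L¹` / in-probability property of the TRUE
   law dynamically (tagged concentration in `τ`), never an exponential one.
   HOT SHARPENING (§3f, checked, being landed): the relay is a HOT witness — every receiving record has partner normal
   speed `|⟪W_c, n⟫| = |c + ⟪η, n⟫| ≥ clo − u > t` and POSITIVE gain `≥ gRec` — so `ExpMomentTailsOf F` is false for every
   nonnegative `F` dominating `(gain)⁺` on own records with partner normal speed `> W`, ANY `W` (`IsHotGainDominating`,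
   `expMomentTailsOf_false_of_hot`); instances: the crux-ideate round-1 residues `hotSupplyOf M` (card
   `coboundary-hot-cold-split`) and `hotDonorGainOf W₀` (card `cool-gains-ride-impulse`) — `hotSupplyExpMoment_false`,
   `hotDonorGainExpMoment_false`.  So whichever hot/cold split a line adopts, its HOT residue inherits the currency
   constraint: `L¹` (`TailsOf`) only; the cards' `HST(M)`/`HSTin`/`HDGT(W₀)` ARE typed in `L¹` — consistent.
4. KINEMATICS (§4, checked): `|Δ‖v‖²|/2 = ‖Δv‖·|⟪V_cm, n̂⟫|` (`reflectVel_energy_jump'`), `energy ≤ impulse × mean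
   speed` (`abs_normSq_sub_normSq_half_le`, `energyOf_le_momentumOf_mul`), Galilean shift
   `Δ_U = ⟪Δv, U⟫` (`energy_jump_boost`).  Consequences: (i) a boost `u₀ ↦ u₀ + U` raises the Gibbs mean of `aᵉ` like
   `|U|·ā_m` — harmless for the crux (`V₀` after `u₀`) but it makes the PROFILE-UNIFORM threshold variant false on
   paper (§5, energy-specific: the momentum twin's uniform variant is Galilean-invariant); (ii) single fast spheres:
   `aᵉ ≈ (σ/τ)u²/2` once (equal-mass thermalisation), `L¹` weight `≲ V e^{−Vτ/(2σθ₀)} → 0`; under the true law at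
   `s > 0` the one-dump channel is `≤ (σ/τ)·KE/(N+1) → 0` by conservation — hyperactivity in energy currency needs
   REPEATED exchange at the same sphere (relay: `L¹`-invisible; co-moving hot platoon: kinetic tails / CAT).
5. LOAD-BEARING HYPOTHESES (§5, typed; paper verdicts): `V₀ > 0` (no-threshold variant FALSE on paper: mean energy
   activity `≍ σ³θ₀^{3/2}(Z−1)·c > 0` by the virial/collision-rate identity), `τ → ∞` (all-windows variant FALSE on
   paper: a sub-mean-free-time window puts its whole mean above any level), `V₀` AFTER `u₀` (uniform-threshold variant
   FALSE on paper, Galilean growth) — all three are STRENGTHENINGS (`…_of_noThreshold/_of_allWindows/_of_uniformThreshold`),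
   none Lean-closable today: each needs a collision-rate FLOOR IN MEAN with an energy weight along the flow from Gibbs
   data (static tube floor landed — `CollisionTubePairMeanLowerBound`; pathwise pull-back landed —
   `CollisionTubePullbackAssembly`; missing: mean control of the short-flight / three-body corrections = the open
   rung-0 stubs of `JParityClosure.RateFloor` / `InformationPercolationEngine.CollisionRate`).  DECORATION: continuity
   of the profiles beyond what `localGibbsLaw` needs, the Euler solution and the `t = 0` LLN except through the horizon
   `T` (the conclusion never mentions `ρ,u,θ`); `σ < σ₀(profiles)` is in the right order (dense/glassy corner excluded).
6. WHY IT RESISTS (substance): a counterexample must make the TRUE pre-shock law carry, with probability `Ω(1)` (not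
   `e^{−cN}`: `L¹` currency, level `V` fixed before `ε`), an energy-activity-weighted mass `≥ ε(N+1)` above a fixed
   level over `τσ² → ∞` mean free times: at equilibrium, non-ergodic tagged energy-transfer rates (persistent relays
   or overpressured cages with positive weighted probability — against equal-mass thermalisation in `O(1)` collisions
   and droplet evaporation `e^{−c(τ/σ)³}`); off equilibrium, spontaneous mesoscopic energy focusing at `O(1)`
   probability.  No rigorous tool controls deterministic hard-sphere dynamics at fixed density beyond Lanford's time in
   either direction (Serre 2021/2024 impulse bounds grow in `N`; Burago–Ferleger–Kononenko 1998 / Burago–Ivanov 2018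
   counts).  Verdict: OPEN, physically true (local equilibrium + tagged LLN; EDMD j022912), formally tight, not
   refutable with present tools; its negation would sink the local-equilibrium picture itself.
7. SEARCHES (this seat, 2026-08-17): `ledger negatives` (20): none of `L¹`-tail shape; nearest 13733 (LD, the witness
   reused here), 9218 `ContactIntensityDomination` (short-time inhomogeneous statics, `h → 0` at fixed `N` — not
   `N`-uniform, no use for long windows); barrier catalogue: `HighMomentumCutoff(Narrow)` (cubic VELOCITY tails, the
   SEET/ECT cruxes, not this functional), `VelocityReversal`, `ShockFormation`, `DiluteRegime` do not bite; lit: see NOTES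
   (inherited: no printed counterexample, no theorem).

## Index
* §1 `energyActivityTails_iff`, `energyActivityTails_iff_negTwin`, `energyActivityTails_of_transferActivityTails`.
* §2 `EquilibriumEnergyActivityTails`, `equilibriumEnergyActivityTails_of_crux`, `not_energyActivityTails_of_not_equilibrium`.
* §3 (copy of the Negative files, namespace `…Disproof.LD`) `energyImpulse`, `IsEnergyDominating`, `ExpMomentTailsOf`,
  `actF`, `collisionSum_ge_of_dominating`, `tailSumF_ge`, `exponentF_ge_tail`, `lintegralF_tail_ge`,
  `expMomentTailsOf_false`, `energySummand`, `EnergyActivityTailsExpMoment`, `energyActivityTailsExpMoment_false`,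
  `transferActivityTailsExpMoment_false'`; §3f `gainImpulse`, `partnerNormalSpeed`, `IsHotGainDominating`,
  `collisionSum_ge_of_hotDominating`, `tailSumH_ge`, `exponentH_ge_tail`, `lintegralH_tail_ge`, `clo_sub_u_gt`,
  `expMomentTailsOf_false_of_hot`, `hotSupplySummand`, `hotDonorGainSummand`, `hotSupplyExpMoment_false`,
  `hotDonorGainExpMoment_false`, `expMomentTailsOf_false'`.
* §4 `reflectVel_energy_jump'`, `abs_normSq_sub_normSq_half_le`, `energyOf_le_momentumOf_mul`, `energy_jump_boost`.
* §5 `TailsOfNoThreshold'`, `TailsOfAllWindows'`, `TailsOfUniformThreshold`, `tailsOf_of_…` ×3.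
* §6 Targets: none this cycle (no line picked; `stuck_stubs = []`); first checks for future stubs listed.
-/

noncomputable section

open MeasureTheory Filter Set Topology Real
open scoped ENNReal InnerProductSpace

namespace Summit.AtomisticToContinuum.HydrodynamicLimit.Cruxes.EnergyActivityTails.Disproof

open Literature.MathematicalPhysics.KineticTheory Literature.Analysis.FluidPDE Literature.Analysis.FunctionSpaces
open Summit.AtomisticToContinuum.HydrodynamicLimit.Theorems
open TransferActivityTailsNegative

/-! ## §1 Read-back and structure -/

/-- **Read-back**: the crux IS `TailsOf energyOf` (the `let`s of the route decl unfold to the landed frame). -/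
theorem energyActivityTails_iff :
    Summit.AtomisticToContinuum.HydrodynamicLimit.Theses.OneFlightGossipEngine.EnergyActivityTails ↔
      TailsOf energyOf :=
  Iff.rfl

/-- The crux IS the landed `TransferActivityTailsNegative.EnergyActivityTails` (byte-identical). -/
theorem energyActivityTails_iff_negTwin :
    Summit.AtomisticToContinuum.HydrodynamicLimit.Theses.OneFlightGossipEngine.EnergyActivityTails ↔
      TransferActivityTailsNegative.EnergyActivityTails :=
  Iff.rfl

/-- TwoClocks' `TransferActivityTails` (16624) implies the crux (domination, landed). -/
theorem energyActivityTails_of_transferActivityTails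
    (h : Summit.AtomisticToContinuum.HydrodynamicLimit.Theses.TwoClocks.TransferActivityTails) :
    Summit.AtomisticToContinuum.HydrodynamicLimit.Theses.OneFlightGossipEngine.EnergyActivityTails :=
  energyActivityTails_iff_negTwin.2 (energyActivityTails_of_crux h)

/-! ## §2 The equilibrium reduction (unconditional) -/

/-- **Equilibrium energy-activity tails** — the global-equilibrium rung of the crux (constant profiles, window
`(0,w]`, canonical Gibbs law): THE refutation target. -/
def EquilibriumEnergyActivityTails : Prop := EquilibriumTailsOf energyOf

/-- **The crux implies its equilibrium rung, unconditionally** (constant hs-Euler states; landed constant-state LLN). -/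
theorem equilibriumEnergyActivityTails_of_crux
    (h : Summit.AtomisticToContinuum.HydrodynamicLimit.Theses.OneFlightGossipEngine.EnergyActivityTails) :
    EquilibriumEnergyActivityTails :=
  equilibriumTailsOf_of_tailsOf energyOf (energyActivityTails_iff.1 h)

/-- Contrapositive: **any counterexample to the equilibrium rung refutes the crux.** -/
theorem not_energyActivityTails_of_not_equilibrium (h : ¬ EquilibriumEnergyActivityTails) :
    ¬ Summit.AtomisticToContinuum.HydrodynamicLimit.Theses.OneFlightGossipEngine.EnergyActivityTails :=
  fun hc => h (equilibriumEnergyActivityTails_of_crux hc)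

/-! ## §3 The LARGE-DEVIATION strengthening is FALSE (in-namespace copy of `Theorems/EnergyActivityTails/Negative/ExpMoment{Lattice,False}.lean`)

Importers: use `Theorems.EnergyActivityTailsNegative.*` once landed (p144661 + part 2); the statements below are
byte-identical with the landed ones (`Iff.rfl`). -/

namespace LD

open EquilibriumClampedCollisionalWindowLDNegative EquilibriumClampedCollisionalWindowLDNegative.Lat

/-! ### §3a The typed strengthening, for a general per-record summand -/


/-- The energy impulse `|‖v⁺‖² − ‖v⁻‖²|/2` of the FIRST particle of a record (the crux's summand on the records
of particle `i` is `energyImpulse c` when `c.fst = i`, else `0`). -/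
def energyImpulse {N : ℕ} (c : Rec N) : ℝ := |‖c.postVel.1‖ ^ 2 - ‖c.preVel.1‖ ^ 2| / 2

/-- The energy impulse is nonnegative. -/
theorem energyImpulse_nonneg {N : ℕ} (c : Rec N) : 0 ≤ energyImpulse c := by
  unfold energyImpulse; positivity

/-- A per-record summand family `F N i` is ENERGY-DOMINATING if it is nonnegative and, on the records whose first
particle is `i`, at least the energy impulse (instances: the crux's energy summand; TwoClocks' transfer summand). -/
def IsEnergyDominating (F : (N : ℕ) → Fin (N + 1) → Rec N → ℝ) : Prop :=
  (∀ N i c, 0 ≤ F N i c) ∧ ∀ N i (c : Rec N), c.fst = i → energyImpulse c ≤ F N i c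

/-- **Exponential-moment (LD) strengthening of the equilibrium window-activity tails for the summand `F`**
(NOT the crux; the crux's window and scale verbatim, constant profiles, canonical Gibbs law):
`∃V₀ ∀V ≥ V₀ ∀β > 0 ∀ε > 0 ∃τ₀ ∀τ ≥ τ₀ ∃N₀ ∀N ≥ N₀`, `∫ exp(β Σᵢ aᵢ𝟙{aᵢ > V}) dG_N ≤ exp(ε(N+1))`,
`aᵢ = (σ/τ) Σ_{records c in (0,w]} F N i c`. -/
def ExpMomentTailsOf (F : (N : ℕ) → Fin (N + 1) → Rec N → ℝ) : Prop :=
  ∀ (a₀ θ₀ : ℝ) (u₀ : V3), 0 < a₀ → 0 < θ₀ → ∃ σ₀ : ℝ, 0 < σ₀ ∧ ∀ σ : ℝ, 0 < σ → σ < σ₀ →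
    ∀ Φ : (N : ℕ) → HardSphereFlow (Torus.geometry (Fin 3)) (hsDiameter σ N) (N + 1),
    ∃ V₀ : ℝ, 0 < V₀ ∧ ∀ V : ℝ, V₀ ≤ V → ∀ β : ℝ, 0 < β → ∀ ε : ℝ, 0 < ε →
    ∃ τ₀ : ℝ, 0 < τ₀ ∧ ∀ τ : ℝ, τ₀ ≤ τ → ∃ N₀ : ℕ, ∀ N : ℕ, N₀ ≤ N →
      ∫⁻ z, ENNReal.ofReal (Real.exp (β * ∑ i : Fin (N + 1),
          Set.indicator {y : ℝ | V < y} (fun y => y)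
            (σ / τ * (Φ N).collisionSum (Set.Ioc 0 (τ * ((N : ℝ) + 1) ^ (-(1 / 3 : ℝ)))) (F N i) z)))
        ∂(localGibbsLaw σ (fun _ => a₀) (fun _ => u₀) (fun _ => θ₀) N (Φ N)) ≤
        ENNReal.ofReal (Real.exp (ε * ((N : ℝ) + 1)))

/-! ### §3b The `F`-activity along the 13733 certificate (pointwise bounds) -/

section Lattice

variable {Λ : EquilibriumClampedCollisionalWindowLDNegative.Lat} {N : ℕ} {a : Fin (N + 1) ≃ Λ.Slot}
variable {Φ : HardSphereFlow (Torus.geometry (Fin 3)) Λ.P.ε (N + 1)}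

/-- The `F`-activity of sphere `p` over the window `(0, w]`, scale `κ = σ/τ` (the crux's `aₚ` for `F = energy`). -/
def actF (Λ : EquilibriumClampedCollisionalWindowLDNegative.Lat) {N : ℕ}
    (Φ : HardSphereFlow (Torus.geometry (Fin 3)) Λ.P.ε (N + 1)) (F : Fin (N + 1) → Rec N → ℝ) (κ : ℝ)
    (p : Fin (N + 1)) (z : Cfg N) : ℝ :=
  κ * Φ.collisionSum (Set.Ioc 0 Λ.w) (F p) z

/-- **The receiving sphere of a transfer is hyperactive in ENERGY**: its windowed `F`-sum is at least the energy
floor `gRec = clo(clo − 2u)/2`, for every nonnegative `F` dominating the energy impulse on its own records (the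
energy impulse of the receiving record alone: `(‖η + c n‖² − ‖η‖²)/2 = c⟪η,n⟫ + c²/2 ≥ c²/2 − cu`, monotone in
`c ≥ clo ≥ 2u`). -/
theorem collisionSum_ge_of_dominating (hW : Λ.WinOK) (hG : Λ.GainOK) (hε : Λ.P.ε < 1 / 2) {z : Cfg N}
    (hz : z ∈ Λ.Ev a) (hgood : z ∈ Φ.good) {F : Fin (N + 1) → Rec N → ℝ} (hF0 : ∀ p c, 0 ≤ F p c)
    (hFE : ∀ p (c : Rec N), c.fst = p → energyImpulse c ≤ F p c)
    {tr : ℕ × (Fin Λ.n × Fin Λ.n) × ℕ} (htr : tr ∈ Λ.transfers a z) :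
    gRec Λ.P ≤ Φ.collisionSum (Set.Ioc 0 Λ.w) (F (Λ.sphJ a tr)) z := by
  classical
  have hΛ := hW.ok
  have hP := hΛ.sep.adm
  rw [collisionSum_window hW hε hz hgood]
  -- every summand is nonnegative
  have hnn : ∀ tr' ∈ Λ.transfers a z, 0 ≤
      F (Λ.sphJ a tr) (HardSphereCollisionRecord.ofConfig (Torus.geometry (Fin 3)) Λ.P.ε
          (Λ.cert a z (Λ.ttime a z tr')) (Λ.ttime a z tr') (Λ.sphI a tr') (Λ.sphJ a tr')) +
        F (Λ.sphJ a tr) (HardSphereCollisionRecord.ofConfig (Torus.geometry (Fin 3)) Λ.P.ε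
          (Λ.cert a z (Λ.ttime a z tr')) (Λ.ttime a z tr') (Λ.sphJ a tr') (Λ.sphI a tr')) :=
    fun tr' _ => add_nonneg (hF0 _ _) (hF0 _ _)
  refine le_trans ?_ (Finset.single_le_sum hnn htr)
  -- the receiving record of `tr`
  obtain ⟨hb, hj, hact, -⟩ := mem_transfers.1 htr
  have hD := dataOK_of_mem hΛ hz hact tr.2.1
  have hf := stepFacts hP hD (by omega : tr.2.2 + 1 ≤ Λ.P.K)
  have hn1 : ‖Λ.trN a z tr‖ = 1 := hf.cont.n_unit
  obtain ⟨-, hpj⟩ := preVel_transfer hW hz htr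
  obtain ⟨-, hvj⟩ := cert_snd_transfer hW hz htr
  set c := Λ.trC a z tr with hc
  have hcge : Λ.P.clo ≤ c := hf.cont.c_ge
  have hη : ‖Λ.trη a z tr‖ ≤ Λ.P.u := hD.η_le (tr.2.2 + 1) (by omega) (by omega)
  have hu := hP.u_nn
  have hclo := hP.clo_pos
  have hc0 : 0 ≤ c := hclo.le.trans hcge
  -- the energy gain of the receiver
  have hexp : ‖Λ.trη a z tr + c • Λ.trN a z tr‖ ^ 2 - ‖Λ.trη a z tr‖ ^ 2 =
      2 * (c * ⟪Λ.trη a z tr, Λ.trN a z tr⟫_ℝ) + c ^ 2 := by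
    rw [norm_add_sq_real, real_inner_smul_right, norm_smul, hn1, mul_one, Real.norm_eq_abs, sq_abs]; ring
  have hin : -Λ.P.u ≤ ⟪Λ.trη a z tr, Λ.trN a z tr⟫_ℝ := by
    have h1 := abs_real_inner_le_norm (Λ.trη a z tr) (Λ.trN a z tr)
    rw [hn1, mul_one] at h1
    have := neg_abs_le (⟪Λ.trη a z tr, Λ.trN a z tr⟫_ℝ)
    linarith
  have hin' : c * (-Λ.P.u) ≤ c * ⟪Λ.trη a z tr, Λ.trN a z tr⟫_ℝ := mul_le_mul_of_nonneg_left hin hc0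
  have hmono : Λ.P.clo * (Λ.P.clo - 2 * Λ.P.u) ≤ c ^ 2 - 2 * (c * Λ.P.u) := by
    have h := mul_nonneg (sub_nonneg.2 hcge) (by linarith [hG.u_le] : 0 ≤ c + Λ.P.clo - 2 * Λ.P.u)
    nlinarith [h]
  have hB : Λ.P.clo * (Λ.P.clo - 2 * Λ.P.u) ≤ ‖Λ.trη a z tr + c • Λ.trN a z tr‖ ^ 2 - ‖Λ.trη a z tr‖ ^ 2 := by
    rw [hexp]; linarith
  -- drop the giving record, read the receiving one through the domination hypothesis
  refine le_trans ?_ (le_add_of_nonneg_left (hF0 _ _))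
  refine le_trans ?_ (hFE _ _ (HardSphereCollisionRecord.ofConfig_fst _ _ _ _ _ _))
  unfold energyImpulse
  simp only [HardSphereCollisionRecord.ofConfig_postVel, hpj, hvj]
  have habs : ‖Λ.trη a z tr + c • Λ.trN a z tr‖ ^ 2 - ‖Λ.trη a z tr‖ ^ 2 ≤
      |‖Λ.trη a z tr + c • Λ.trN a z tr‖ ^ 2 - ‖Λ.trη a z tr‖ ^ 2| := le_abs_self _
  unfold gRec
  linarith

/-- **The tail sum on a labelled event**: if the activity floor `κ · gRec` exceeds the level `V`, then
`Tlow · κ · gRec ≤ Σₚ aₚ 𝟙{aₚ > V}` (distinct transfers have distinct receivers; `≥ Tlow` transfers). -/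
theorem tailSumF_ge (hW : Λ.WinOK) (hG : Λ.GainOK) (hε : Λ.P.ε < 1 / 2) {z : Cfg N} (hz : z ∈ Λ.Ev a)
    (hgood : z ∈ Φ.good) {F : Fin (N + 1) → Rec N → ℝ} (hF0 : ∀ p c, 0 ≤ F p c)
    (hFE : ∀ p (c : Rec N), c.fst = p → energyImpulse c ≤ F p c)
    {κ V : ℝ} (hκ : 0 ≤ κ) (hV : V < κ * gRec Λ.P) {kw : ℕ} (hkK : kw + 1 ≤ Λ.P.K)
    (hkw : (kw : ℝ) * Λ.P.θhi ≤ Λ.w) (hM : 24 * Λ.m ≤ Λ.M) :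
    Λ.Tlow kw * (κ * gRec Λ.P) ≤
      ∑ p : Fin (N + 1), Set.indicator {y : ℝ | V < y} (fun y => y) (actF Λ Φ F κ p z) := by
  classical
  have hΛ := hW.ok
  have hg0 := gRec_nonneg hΛ hG
  -- every sphere's tail term is nonnegative
  have hact0 : ∀ p, 0 ≤ actF Λ Φ F κ p z := by
    intro p
    unfold actF
    refine mul_nonneg hκ ?_
    rw [HardSphereFlow.collisionSum_eq, collisionSum_eq_collisionPairSum]
    exact collisionPairSum_nonneg fun _ _ _ => hF0 _ _
  have htail0 : ∀ p, 0 ≤ Set.indicator {y : ℝ | V < y} (fun y => y) (actF Λ Φ F κ p z) := fun p =>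
    Set.indicator_apply_nonneg fun _ => hact0 p
  -- the receivers are hyperactive
  have hrecv : ∀ tr ∈ Λ.transfers a z,
      κ * gRec Λ.P ≤ Set.indicator {y : ℝ | V < y} (fun y => y) (actF Λ Φ F κ (Λ.sphJ a tr) z) := by
    intro tr htr
    have h1 : κ * gRec Λ.P ≤ actF Λ Φ F κ (Λ.sphJ a tr) z :=
      mul_le_mul_of_nonneg_left (collisionSum_ge_of_dominating hW hG hε hz hgood hF0 hFE htr) hκ
    rw [Set.indicator_of_mem (show actF Λ Φ F κ (Λ.sphJ a tr) z ∈ {y : ℝ | V < y} from hV.trans_le h1)]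
    exact h1
  -- count
  have hT : Λ.Tlow kw ≤ ((Λ.transfers a z).card : ℝ) := by
    have h1 := card_transfers_ge (a := a) hΛ hz hkK hkw
    have h2 := card_active_ge Λ hΛ hM
    have h1' : ((((Finset.range Λ.Q).filter Λ.Active).card * (Λ.n * Λ.n) * kw : ℕ) : ℝ) ≤
        (Λ.transfers a z).card := by
      exact_mod_cast h1
    push_cast at h1'
    unfold Lat.Tlow
    have : (0 : ℝ) ≤ (Λ.n : ℝ) * Λ.n * kw := by positivity
    nlinarith
  calc Λ.Tlow kw * (κ * gRec Λ.P) ≤ ((Λ.transfers a z).card : ℝ) * (κ * gRec Λ.P) :=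
        mul_le_mul_of_nonneg_right hT (mul_nonneg hκ hg0)
    _ = ∑ _tr ∈ Λ.transfers a z, κ * gRec Λ.P := by rw [Finset.sum_const, nsmul_eq_mul]
    _ ≤ ∑ tr ∈ Λ.transfers a z, Set.indicator {y : ℝ | V < y} (fun y => y) (actF Λ Φ F κ (Λ.sphJ a tr) z) :=
        Finset.sum_le_sum hrecv
    _ = ∑ p ∈ (Λ.transfers a z).image (Λ.sphJ a),
          Set.indicator {y : ℝ | V < y} (fun y => y) (actF Λ Φ F κ p z) := by
        rw [Finset.sum_image fun tr htr tr' htr' h => sphJ_inj hΛ htr htr' h]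
    _ ≤ ∑ p : Fin (N + 1), Set.indicator {y : ℝ | V < y} (fun y => y) (actF Λ Φ F κ p z) :=
        Finset.sum_le_univ_sum_of_nonneg fun p => htail0 p

/-- **Pointwise exponent bound on a labelled event**: the 13733 exponent at `Z = 1` is dominated by `B` times
the tail sum as soon as `2β ≤ B` and `ε ≤ κ w` (then `gainT/w ≤ 2κ·gRec`). -/
theorem exponentF_ge_tail (hW : Λ.WinOK) (hG : Λ.GainOK) (hε : Λ.P.ε < 1 / 2) (hw0 : 0 < Λ.w) {z : Cfg N}
    (hz : z ∈ Λ.Ev a) (hgood : z ∈ Φ.good) {F : Fin (N + 1) → Rec N → ℝ} (hF0 : ∀ p c, 0 ≤ F p c)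
    (hFE : ∀ p (c : Rec N), c.fst = p → energyImpulse c ≤ F p c)
    {κ V β B : ℝ} (hκ : 0 ≤ κ) (hV : V < κ * gRec Λ.P) (hβ : 0 ≤ β)
    (hB : 2 * β ≤ B) (hκε : Λ.P.ε ≤ κ * Λ.w) {kw : ℕ} (hkK : kw + 1 ≤ Λ.P.K) (hkw : (kw : ℝ) * Λ.P.θhi ≤ Λ.w)
    (hM : 24 * Λ.m ≤ Λ.M) :
    Λ.Fmin N kw β 1 ≤ B * ∑ p : Fin (N + 1), Set.indicator {y : ℝ | V < y} (fun y => y) (actF Λ Φ F κ p z) := by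
  have hΛ := hW.ok
  have hg0 := gRec_nonneg hΛ hG
  have hS := tailSumF_ge hW hG hε hz hgood hF0 hFE hκ hV hkK hkw hM
  have hS0 : 0 ≤ ∑ p : Fin (N + 1), Set.indicator {y : ℝ | V < y} (fun y => y) (actF Λ Φ F κ p z) :=
    le_trans (mul_nonneg (by unfold Lat.Tlow; positivity) (mul_nonneg hκ hg0)) hS
  have hT0 : 0 ≤ Λ.Tlow kw := by unfold Lat.Tlow; positivity
  have hwi : 0 < Λ.w⁻¹ := inv_pos.2 hw0
  -- `w⁻¹ gainT ≤ 2 κ gRec`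
  have hgain : Λ.w⁻¹ * gainT Λ.P ≤ 2 * (κ * gRec Λ.P) := by
    have h1 : Λ.w⁻¹ * gainT Λ.P ≤ Λ.w⁻¹ * (2 * Λ.P.ε * gRec Λ.P) :=
      mul_le_mul_of_nonneg_left (gainT_le hΛ hG) hwi.le
    have h2 : Λ.w⁻¹ * Λ.P.ε ≤ κ := by
      rw [inv_mul_le_iff₀ hw0]; linarith [hκε]
    calc Λ.w⁻¹ * gainT Λ.P ≤ Λ.w⁻¹ * (2 * Λ.P.ε * gRec Λ.P) := h1
      _ = 2 * (Λ.w⁻¹ * Λ.P.ε) * gRec Λ.P := by ring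
      _ ≤ 2 * κ * gRec Λ.P := by gcongr
      _ = 2 * (κ * gRec Λ.P) := by ring
  have hmain : Λ.w⁻¹ * (Λ.Tlow kw * gainT Λ.P) ≤
      2 * ∑ p : Fin (N + 1), Set.indicator {y : ℝ | V < y} (fun y => y) (actF Λ Φ F κ p z) := by
    calc Λ.w⁻¹ * (Λ.Tlow kw * gainT Λ.P) = Λ.Tlow kw * (Λ.w⁻¹ * gainT Λ.P) := by ring
      _ ≤ Λ.Tlow kw * (2 * (κ * gRec Λ.P)) := mul_le_mul_of_nonneg_left hgain hT0
      _ = 2 * (Λ.Tlow kw * (κ * gRec Λ.P)) := by ring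
      _ ≤ _ := by linarith [hS]
  unfold Lat.Fmin
  simp only [sub_self, abs_zero, zero_mul, mul_zero, sub_zero]
  calc β * (Λ.w⁻¹ * (Λ.Tlow kw * gainT Λ.P))
      ≤ β * (2 * ∑ p : Fin (N + 1), Set.indicator {y : ℝ | V < y} (fun y => y) (actF Λ Φ F κ p z)) :=
        mul_le_mul_of_nonneg_left hmain hβ
    _ = (2 * β) * ∑ p : Fin (N + 1), Set.indicator {y : ℝ | V < y} (fun y => y) (actF Λ Φ F κ p z) := by ring
    _ ≤ B * ∑ p : Fin (N + 1), Set.indicator {y : ℝ | V < y} (fun y => y) (actF Λ Φ F κ p z) :=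
        mul_le_mul_of_nonneg_right hB hS0

end Lattice




/-! ### §3c The Gibbs lower bound on the labelled events -/

section Lattice

variable {Λ : EquilibriumClampedCollisionalWindowLDNegative.Lat} {N : ℕ} {a : Fin (N + 1) ≃ Λ.Slot}
variable {Φ : HardSphereFlow (Torus.geometry (Fin 3)) Λ.P.ε (N + 1)}

/-- **The main lower bound for the exponential moment of the `F`-tail sum**:
`(N+1)! · e^{Fmin N kw β 1} · evB ≤ ∫ exp(B Σₚ aₚ𝟙{aₚ>V}) dG_N`. -/
theorem lintegralF_tail_ge (hcardN : Fintype.card Λ.Slot = N + 1) (hW : Λ.WinOK) (hG : Λ.GainOK)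
    (hε : Λ.P.ε < 1 / 2) (hr : Λ.P.r < 1 / 2) (hw0 : 0 < Λ.w) {σ : ℝ} (hσ : σ ≤ 1 / 2)
    (hεσ : hsDiameter σ N = Λ.P.ε)
    (hgoodP : localGibbsMeasure σ (fun _ => 1) (fun _ => 0) (fun _ => (1 : ℝ)) N Φ.goodᶜ = 0)
    {F : Fin (N + 1) → Rec N → ℝ} (hF0 : ∀ p c, 0 ≤ F p c)
    (hFE : ∀ p (c : Rec N), c.fst = p → energyImpulse c ≤ F p c)
    {κ V β B : ℝ} (hκ : 0 ≤ κ) (hV : V < κ * gRec Λ.P) (hβ : 0 ≤ β) (hB : 2 * β ≤ B) (hκε : Λ.P.ε ≤ κ * Λ.w)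
    {kw : ℕ} (hkK : kw + 1 ≤ Λ.P.K) (hkw : (kw : ℝ) * Λ.P.θhi ≤ Λ.w) (hM : 24 * Λ.m ≤ Λ.M) :
    ENNReal.ofReal (((N + 1).factorial : ℝ) * Real.exp (Λ.Fmin N kw β 1) * Λ.evB N) ≤
      ∫⁻ z, ENNReal.ofReal (Real.exp (B * ∑ p : Fin (N + 1),
          Set.indicator {y : ℝ | V < y} (fun y => y) (actF Λ Φ F κ p z)))
        ∂(localGibbsMeasure σ (fun _ => 1) (fun _ => 0) (fun _ => (1 : ℝ)) N) := by
  classical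
  set P := localGibbsMeasure σ (fun _ => 1) (fun _ => 0) (fun _ => (1 : ℝ)) N with hP
  set f : Cfg N → ENNReal := fun z => ENNReal.ofReal (Real.exp (B * ∑ p : Fin (N + 1),
      Set.indicator {y : ℝ | V < y} (fun y => y) (actF Λ Φ F κ p z)))
  set c : ENNReal := ENNReal.ofReal (Real.exp (Λ.Fmin N kw β 1)) with hc
  -- Step 1: restrict to the disjoint union of the labelled events
  have hmeas : ∀ a : Fin (N + 1) ≃ Λ.Slot, MeasurableSet (Λ.Ev a : Set (Cfg N)) := fun a => measurableSet_Ev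
  have hdisj : Pairwise (Function.onFun Disjoint fun a : Fin (N + 1) ≃ Λ.Slot => (Λ.Ev a : Set (Cfg N))) :=
    fun a a' h => Ev_disjoint hW h
  have step1 : ∑ a : Fin (N + 1) ≃ Λ.Slot, ∫⁻ z in Λ.Ev a, f z ∂P ≤ ∫⁻ z, f z ∂P := by
    have h := lintegral_iUnion (μ := P) hmeas hdisj f
    rw [tsum_fintype] at h
    rw [← h]
    exact setLIntegral_le_lintegral _ _
  -- Step 2: on each event the integrand is at least `c` off the null set `goodᶜ`
  have step2 : ∀ a : Fin (N + 1) ≃ Λ.Slot, c * P (Λ.Ev a) ≤ ∫⁻ z in Λ.Ev a, f z ∂P := by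
    intro a
    have hpt : ∀ z ∈ Λ.Ev a, (Φ.good).indicator (fun _ => c) z ≤ f z := by
      intro z hz
      by_cases hg : z ∈ Φ.good
      · rw [Set.indicator_of_mem hg]
        exact ENNReal.ofReal_le_ofReal (Real.exp_le_exp.2
          (exponentF_ge_tail hW hG hε hw0 hz hg hF0 hFE hκ hV hβ hB hκε hkK hkw hM))
      · rw [Set.indicator_of_notMem hg]; exact bot_le
    calc c * P (Λ.Ev a) ≤ c * P (Φ.good ∩ Λ.Ev a) := by
          refine mul_le_mul' le_rfl ?_
          have hsub : (Λ.Ev a : Set (Cfg N)) ⊆ (Φ.good ∩ Λ.Ev a) ∪ Φ.goodᶜ := by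
            intro z hz; by_cases hg : z ∈ Φ.good
            · exact Or.inl ⟨hg, hz⟩
            · exact Or.inr hg
          calc P (Λ.Ev a) ≤ P ((Φ.good ∩ Λ.Ev a) ∪ Φ.goodᶜ) := measure_mono hsub
            _ ≤ P (Φ.good ∩ Λ.Ev a) + P Φ.goodᶜ := measure_union_le _ _
            _ = P (Φ.good ∩ Λ.Ev a) := by rw [hgoodP, add_zero]
      _ = ∫⁻ z in Λ.Ev a, (Φ.good).indicator (fun _ => c) z ∂P := by
          rw [lintegral_indicator_const Φ.measurableSet_good, Measure.restrict_apply Φ.measurableSet_good]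
      _ ≤ ∫⁻ z in Λ.Ev a, f z ∂P := setLIntegral_mono' (hmeas a) hpt
  -- Step 3: the uniform measure bound and the count of labellings
  have step3 : ∀ a : Fin (N + 1) ≃ Λ.Slot, c * ENNReal.ofReal (Λ.evB N) ≤ c * P (Λ.Ev a) := fun a =>
    mul_le_mul' le_rfl (measure_Ev_ge (a := a) hW hσ hεσ hr)
  have hcardE : Fintype.card (Fin (N + 1) ≃ Λ.Slot) = (N + 1).factorial := by
    have e : Fin (N + 1) ≃ Λ.Slot := Fintype.equivOfCardEq (by rw [Fintype.card_fin, hcardN])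
    rw [Fintype.card_equiv e, Fintype.card_fin]
  calc ENNReal.ofReal (((N + 1).factorial : ℝ) * Real.exp (Λ.Fmin N kw β 1) * Λ.evB N)
      = ((N + 1).factorial : ENNReal) * (c * ENNReal.ofReal (Λ.evB N)) := by
        rw [ENNReal.ofReal_mul (by positivity), ENNReal.ofReal_mul (by positivity), ENNReal.ofReal_natCast, hc,
          mul_assoc]
    _ = ∑ _a : Fin (N + 1) ≃ Λ.Slot, c * ENNReal.ofReal (Λ.evB N) := by
        rw [Finset.sum_const, Finset.card_univ, hcardE, nsmul_eq_mul]
    _ ≤ ∑ a : Fin (N + 1) ≃ Λ.Slot, ∫⁻ z in Λ.Ev a, f z ∂P :=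
        Finset.sum_le_sum fun a _ => (step3 a).trans (step2 a)
    _ ≤ _ := step1

end Lattice

/-! ### §3d The refutation of the strengthening, for every energy-dominating summand -/

/-- **The exponential-moment strengthening of the equilibrium `F`-activity tails is false for every nonnegative
summand `F` dominating the energy impulse on its own records**, by the frozen line-lattice Newton-cradle witness of
the 13733 refutation: equilibrium data `a₀ = θ₀ = 1, u₀ = 0`, `σ = (4/5)/l²`, `V = max V₀ 1`, `β = 2`, `ε = 1`,
`τ = t⁴`, `N + 1 = (l n)³`; every receiving sphere of the relay carries ENERGY activity `≥ (9/100) t²/l² > V`, so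
`2 Σᵢ aᵢ𝟙{aᵢ>V}` dominates the 13733 exponent at `Z = 1` and the 13733 final inequality applies verbatim. -/
theorem expMomentTailsOf_false {F : (N : ℕ) → Fin (N + 1) → Rec N → ℝ} (hF : IsEnergyDominating F) :
    ¬ ExpMomentTailsOf F := by
  classical
  intro H
  obtain ⟨hF0, hFE⟩ := hF
  obtain ⟨σ₀, hσ₀, H⟩ := H 1 1 (0 : V3) one_pos one_pos
  -- the packing fraction `σ = (4/5)/l²`
  obtain ⟨l, hl, hlσ⟩ : ∃ l : ℕ, 2 ≤ l ∧ (4 / 5 : ℝ) / (l : ℝ) ^ 2 < σ₀ := by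
    refine ⟨⌈1 / σ₀⌉₊ + 2, by omega, ?_⟩
    have h1 : 1 / σ₀ ≤ ⌈1 / σ₀⌉₊ := Nat.le_ceil _
    have hl2 : (1 / σ₀ : ℝ) + 2 ≤ ((⌈1 / σ₀⌉₊ + 2 : ℕ) : ℝ) := by push_cast; linarith
    have hpos : 0 < 1 / σ₀ := by positivity
    set L : ℝ := ((⌈1 / σ₀⌉₊ + 2 : ℕ) : ℝ)
    have hL : 1 / σ₀ < L := by linarith
    have hL1 : 1 ≤ L := by linarith
    rw [div_lt_iff₀ (by positivity)]
    have : 1 < σ₀ * L := by rwa [div_lt_iff₀' hσ₀] at hL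
    nlinarith
  set σ : ℝ := (4 / 5) / (l : ℝ) ^ 2 with hσdef
  have hl0 : (0 : ℝ) < l := by exact_mod_cast (show 0 < l by omega)
  have hl2 : (2 : ℝ) ≤ l := by exact_mod_cast hl
  have hσ : 0 < σ := by positivity
  have hσ5 : σ ≤ 1 / 5 := by
    rw [hσdef, div_le_iff₀ (by positivity)]; nlinarith
  have hσ2 : σ < 1 / 2 := by linarith
  specialize H σ hσ hlσ (flowFam hσ hσ2)
  obtain ⟨V₀, hV₀, H⟩ := H
  specialize H (max V₀ 1) (le_max_left _ _) 2 two_pos 1 one_pos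
  obtain ⟨τ₀, hτ₀, H⟩ := H
  -- the choice of `t` (`τ = t⁴`)
  obtain ⟨t, ht, hτt, hbig, htV⟩ : ∃ t : ℕ, 24 * l ^ 2 ≤ t ∧ τ₀ ≤ (t : ℝ) ^ 4 ∧
      39 * (l : ℝ) ^ 2 * (224 + 6 * l + 40 * 1 * |(1 : ℝ) - 1|) ≤ 1 * t ∧ max V₀ 1 < t := by
    set X : ℝ := 39 * (l : ℝ) ^ 2 * (224 + 6 * l) with hX
    refine ⟨⌈τ₀⌉₊ + 24 * l ^ 2 + ⌈X⌉₊ + ⌈max V₀ 1⌉₊ + 1, by omega, ?_, ?_, ?_⟩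
    · have h1 : τ₀ ≤ ⌈τ₀⌉₊ := Nat.le_ceil _
      have h2 : (⌈τ₀⌉₊ : ℝ) ≤ ((⌈τ₀⌉₊ + 24 * l ^ 2 + ⌈X⌉₊ + ⌈max V₀ 1⌉₊ + 1 : ℕ) : ℝ) := by
        exact_mod_cast (by omega)
      have h3 : (1 : ℝ) ≤ ((⌈τ₀⌉₊ + 24 * l ^ 2 + ⌈X⌉₊ + ⌈max V₀ 1⌉₊ + 1 : ℕ) : ℝ) := by
        exact_mod_cast (by omega)
      calc τ₀ ≤ ((⌈τ₀⌉₊ + 24 * l ^ 2 + ⌈X⌉₊ + ⌈max V₀ 1⌉₊ + 1 : ℕ) : ℝ) := h1.trans h2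
        _ = ((⌈τ₀⌉₊ + 24 * l ^ 2 + ⌈X⌉₊ + ⌈max V₀ 1⌉₊ + 1 : ℕ) : ℝ) ^ 1 := (pow_one _).symm
        _ ≤ _ := pow_le_pow_right₀ h3 (by norm_num)
    · have h1 : X ≤ ⌈X⌉₊ := Nat.le_ceil _
      have h2 : (⌈X⌉₊ : ℝ) ≤ ((⌈τ₀⌉₊ + 24 * l ^ 2 + ⌈X⌉₊ + ⌈max V₀ 1⌉₊ + 1 : ℕ) : ℝ) := by
        exact_mod_cast (by omega)
      rw [sub_self, abs_zero, mul_zero, add_zero, one_mul]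
      exact h1.trans h2
    · have h1 : max V₀ 1 ≤ ⌈max V₀ 1⌉₊ := Nat.le_ceil _
      have h2 : ((⌈max V₀ 1⌉₊ + 1 : ℕ) : ℝ) ≤ ((⌈τ₀⌉₊ + 24 * l ^ 2 + ⌈X⌉₊ + ⌈max V₀ 1⌉₊ + 1 : ℕ) : ℝ) := by
        exact_mod_cast (by omega)
      push_cast at h2 ⊢
      linarith
  specialize H ((t : ℝ) ^ 4) hτt
  obtain ⟨N₀, H⟩ := H
  -- the choice of `n` and `N + 1 = (l n)³`
  set n : ℕ := N₀ + 18 * t ^ 7 * l ^ 2 + 10 with hn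
  have hn2 : 2 ≤ n := by omega
  have hn1 : 1 ≤ n := by omega
  set N : ℕ := (l * n) ^ 3 - 1 with hNdef
  have hln : 1 ≤ l * n := Nat.mul_pos (by omega) (by omega)
  have hN : N + 1 = (l * n) ^ 3 := by
    have : 1 ≤ (l * n) ^ 3 := Nat.one_le_pow _ _ hln; omega
  have hN₀ : N₀ ≤ N := by
    have h1 : l * n ≤ (l * n) ^ 3 := by
      calc l * n = (l * n) ^ 1 := (pow_one _).symm
        _ ≤ (l * n) ^ 3 := Nat.pow_le_pow_right hln (by norm_num)
    have h2 : n ≤ l * n := Nat.le_mul_of_pos_left n (by omega)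
    omega
  have hE := H N hN₀
  -- the lattice
  set Λ := LatW' l n t with hΛ
  have hΛeq : Λ = LatW l n t := LatW'_eq hl hn1
  have hcard : Fintype.card Λ.Slot = N + 1 := by rw [hΛeq, LatW.card_slot, hN]
  have hchart : 4 * (6 * (t : ℝ) ^ 7 * (l : ℝ) ^ 2 + 4) ≤ (l : ℝ) ^ 3 * n := by
    have hn' : ((18 * t ^ 7 * l ^ 2 + 10 : ℕ) : ℝ) ≤ n := by exact_mod_cast (by omega)
    push_cast at hn'
    have hl8 : (8 : ℝ) ≤ (l : ℝ) ^ 3 := by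
      have := pow_le_pow_left₀ (by norm_num : (0:ℝ) ≤ 2) hl2 3; norm_num at this; exact this
    have h0 : (0 : ℝ) ≤ (t : ℝ) ^ 7 * (l : ℝ) ^ 2 := by positivity
    have h1 : (8 : ℝ) * n ≤ (l : ℝ) ^ 3 * n := mul_le_mul_of_nonneg_right hl8 (by positivity)
    nlinarith
  have hW : Λ.WinOK := by rw [hΛeq]; exact LatW.winOK hl ht hn1 hchart
  have hG : Λ.GainOK := by rw [hΛeq]; exact LatW.gainOK hl ht hn1
  obtain ⟨hε12, hr12, -⟩ : Λ.P.ε < 1 / 2 ∧ Λ.P.r < 1 / 2 ∧ (4 / 5 : ℝ) / (l : ℝ) ^ 2 ≤ 1 / 2 := by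
    rw [hΛeq]; exact LatW.small_facts hl ht hn1
  have hT := bpar.Tpos hl ht
  have hc := LatW.c_pos (l := l) (n := n) hl hn1
  have hw0 : 0 < Λ.w := by show 0 < cscale l n * ((t : ℝ) ^ 4 * (l : ℝ) ^ 2); positivity
  have hεσ : hsDiameter σ N = Λ.P.ε := rfl
  have hgoodP : localGibbsMeasure σ (fun _ => 1) (fun _ => 0) (fun _ => (1 : ℝ)) N (flowFam hσ hσ2 N).goodᶜ = 0 :=
    localGibbsMeasure_absolutelyContinuous σ _ _ _ N (flowFam hσ hσ2 N) (flowFam hσ hσ2 N).measure_compl_good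
  have hκ : 0 ≤ σ / (t : ℝ) ^ 4 := by positivity
  -- the activity floor beats the level
  have hVlt : max V₀ 1 < σ / (t : ℝ) ^ 4 * gRec Λ.P := by
    rw [hΛeq]
    have hg := gRec_ge (l := l) (n := n) (t := t) hl ht hn2
    have ht' : ((24 * l ^ 2 : ℕ) : ℝ) ≤ t := by exact_mod_cast ht
    push_cast at ht'
    have h1 : σ / (t : ℝ) ^ 4 * ((9 / 80 : ℝ) * (t : ℝ) ^ 6) ≤ σ / (t : ℝ) ^ 4 * gRec (LatW l n t).P :=
      mul_le_mul_of_nonneg_left hg hκ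
    have h2 : σ / (t : ℝ) ^ 4 * ((9 / 80 : ℝ) * (t : ℝ) ^ 6) = (9 / 100) * (t : ℝ) ^ 2 / (l : ℝ) ^ 2 := by
      rw [hσdef]; field_simp; ring
    have h3 : (t : ℝ) < (9 / 100) * (t : ℝ) ^ 2 / (l : ℝ) ^ 2 := by
      rw [lt_div_iff₀ (by positivity)]
      nlinarith
    linarith
  have hκε : Λ.P.ε ≤ σ / (t : ℝ) ^ 4 * Λ.w := by
    rw [hΛeq, hσdef]; exact le_of_eq (ε_eq_κw (n := n) hl ht)
  obtain ⟨-, -, -, w4, w5, -⟩ := bpar.win_facts hl ht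
  have hkK : 4 * t ^ 7 * l ^ 2 + 1 ≤ Λ.P.K := by rw [hΛeq]; exact w5
  have hkw : ((4 * t ^ 7 * l ^ 2 : ℕ) : ℝ) * Λ.P.θhi ≤ Λ.w := by
    rw [hΛeq, LatW.P_eq, Params.scale_θhi _ hc.ne', LatW.w_eq]
    calc ((4 * t ^ 7 * l ^ 2 : ℕ) : ℝ) * (cscale l n * (bpar l t).θhi)
        = cscale l n * (((4 * t ^ 7 * l ^ 2 : ℕ) : ℝ) * (bpar l t).θhi) := by ring
      _ ≤ cscale l n * ((t : ℝ) ^ 4 * (l : ℝ) ^ 2) := mul_le_mul_of_nonneg_left w4 hc.le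
  have hM : 24 * Λ.m ≤ Λ.M := by
    show 24 * (6 * t ^ 7 * l ^ 2 + 3) ≤ l ^ 3 * n
    have hl8 : 8 ≤ l ^ 3 := by
      calc 8 = 2 ^ 3 := by norm_num
        _ ≤ l ^ 3 := Nat.pow_le_pow_left hl 3
    have hn' : 18 * t ^ 7 * l ^ 2 + 10 ≤ n := by omega
    calc 24 * (6 * t ^ 7 * l ^ 2 + 3) = 8 * (18 * t ^ 7 * l ^ 2 + 9) := by ring
      _ ≤ l ^ 3 * n := Nat.mul_le_mul hl8 (by omega)
  -- the main bound and the final inequality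
  have key := lintegralF_tail_ge (Λ := Λ) (Φ := flowFam hσ hσ2 N) hcard hW hG hε12 hr12 hw0 (by linarith) hεσ
    hgoodP (F := F N) (hF0 N) (hFE N) (V := max V₀ 1) (β := 1) (B := 2) hκ hVlt zero_le_one (by norm_num) hκε
    hkK hkw hM
  have hfin := LatW.final_ineq hl ht hn2 hN one_pos 1 hbig
  rw [← hΛeq] at hfin
  have hlt : ENNReal.ofReal (Real.exp (1 * ((N : ℝ) + 1))) <
      ENNReal.ofReal (((N + 1).factorial : ℝ) * Real.exp (Λ.Fmin N (4 * t ^ 7 * l ^ 2) 1 1) * Λ.evB N) := by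
    rw [one_mul, ENNReal.ofReal_lt_ofReal_iff (lt_trans (Real.exp_pos _) hfin)]
    exact hfin
  -- identify the statement's integral with ours
  have hw : (t : ℝ) ^ 4 * ((N : ℝ) + 1) ^ (-(1 / 3 : ℝ)) = Λ.w := by
    rw [LatW.w_eq_stmt (t := t) hl hn1 hN, hΛeq]
  rw [localGibbsLaw_eq, hw] at hE
  exact absurd (lt_of_lt_of_le hlt (key.trans hE)) (lt_irrefl _)

/-! ### §3e Instances: the crux's energy summand (THE negative lemma of 17703) and TwoClocks' transfer summand -/

/-- The crux's energy summand, verbatim: `|‖v⁺‖² − ‖v⁻‖²|/2` on the records of particle `i`, `0` else. -/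
def energySummand (N : ℕ) (i : Fin (N + 1)) (c : Rec N) : ℝ :=
  if c.fst = i then |‖c.postVel.1‖ ^ 2 - ‖c.preVel.1‖ ^ 2| / 2 else 0

/-- The energy summand is energy-dominating (with equality on its own records). -/
theorem isEnergyDominating_energySummand : IsEnergyDominating energySummand := by
  refine ⟨fun N i c => ?_, fun N i c h => ?_⟩
  · unfold energySummand; split_ifs <;> positivity
  · unfold energySummand energyImpulse; rw [if_pos h]

/-- **Exponential-moment (LD) strengthening of the equilibrium rung of the crux `EnergyActivityTails`** (NOT the
crux; its summand, window and scale verbatim, constant profiles, canonical Gibbs law):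
`∃V₀ ∀V ≥ V₀ ∀β > 0 ∀ε > 0 ∃τ₀ ∀τ ≥ τ₀ ∃N₀ ∀N ≥ N₀`, `∫ exp(β Σᵢ aᵉᵢ𝟙{aᵉᵢ > V}) dG_N ≤ exp(ε(N+1))`. -/
def EnergyActivityTailsExpMoment : Prop :=
  ∀ (a₀ θ₀ : ℝ) (u₀ : V3), 0 < a₀ → 0 < θ₀ → ∃ σ₀ : ℝ, 0 < σ₀ ∧ ∀ σ : ℝ, 0 < σ → σ < σ₀ →
    ∀ Φ : (N : ℕ) → HardSphereFlow (Torus.geometry (Fin 3)) (hsDiameter σ N) (N + 1),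
    ∃ V₀ : ℝ, 0 < V₀ ∧ ∀ V : ℝ, V₀ ≤ V → ∀ β : ℝ, 0 < β → ∀ ε : ℝ, 0 < ε →
    ∃ τ₀ : ℝ, 0 < τ₀ ∧ ∀ τ : ℝ, τ₀ ≤ τ → ∃ N₀ : ℕ, ∀ N : ℕ, N₀ ≤ N →
      ∫⁻ z, ENNReal.ofReal (Real.exp (β * ∑ i : Fin (N + 1),
          Set.indicator {y : ℝ | V < y} (fun y => y)
            (σ / τ * (Φ N).collisionSum (Set.Ioc 0 (τ * ((N : ℝ) + 1) ^ (-(1 / 3 : ℝ))))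
              (fun c => if c.fst = i then |‖c.postVel.1‖ ^ 2 - ‖c.preVel.1‖ ^ 2| / 2 else 0) z)))
        ∂(localGibbsLaw σ (fun _ => a₀) (fun _ => u₀) (fun _ => θ₀) N (Φ N)) ≤
        ENNReal.ofReal (Real.exp (ε * ((N : ℝ) + 1)))

/-- Read-back: the typed strengthening IS `ExpMomentTailsOf energySummand` (definitional). -/
theorem energyActivityTailsExpMoment_iff : EnergyActivityTailsExpMoment ↔ ExpMomentTailsOf energySummand :=
  Iff.rfl

/-- **THE negative lemma of stmt-17703: the exponential-moment (LD) strengthening of the equilibrium energy-activity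
tails is FALSE** (Newton-cradle relay; see the module docstring).  The crux itself (an `L¹` statement) is untouched. -/
theorem energyActivityTailsExpMoment_false : ¬ EnergyActivityTailsExpMoment :=
  fun h => expMomentTailsOf_false isEnergyDominating_energySummand (energyActivityTailsExpMoment_iff.1 h)

/-- TwoClocks' transfer summand `‖Δvᵢ‖ + |Δ‖vᵢ‖²|/2` (stmt-16624) is energy-dominating. -/
theorem isEnergyDominating_transferSummand :
    IsEnergyDominating (fun (N : ℕ) (i : Fin (N + 1)) (c : Rec N) =>
      if c.fst = i then ‖c.postVel.1 - c.preVel.1‖ + |‖c.postVel.1‖ ^ 2 - ‖c.preVel.1‖ ^ 2| / 2 else 0) := by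
  refine ⟨fun N i c => ?_, fun N i c h => ?_⟩
  · dsimp only; split_ifs <;> positivity
  · dsimp only; unfold energyImpulse; rw [if_pos h]
    exact le_add_of_nonneg_left (norm_nonneg _)

/-- The landed `TransferActivityTailsNegative.transferActivityTailsExpMoment_false` (TwoClocks' 16624, p127643)
re-derived as the instance `F = transfer` of `expMomentTailsOf_false` — the energy lemma is the stronger negative. -/
theorem transferActivityTailsExpMoment_false' : ¬ TransferActivityTailsNegative.TransferActivityTailsExpMoment :=
  fun h => expMomentTailsOf_false isEnergyDominating_transferSummand h



/-! ### §3f HOT version (in-namespace copy of `Negative/ExpMomentHot{Lattice,False}.lean`, p145161/p145165): the relay is a hot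
witness, so the LD currency dies for every HOT-GAIN-dominating summand — in particular for the crux-ideate round-1 residues
`hotSupplyOf M` / `hotDonorGainOf W₀` at every level. -/

/-! #### Hot-gain domination -/

/-- The SIGNED kinetic-energy gain `(‖v⁺‖² − ‖v⁻‖²)/2` of the first particle of a record (`energyImpulse = |gainImpulse|`). -/
def gainImpulse {N : ℕ} (c : Rec N) : ℝ := (‖c.postVel.1‖ ^ 2 - ‖c.preVel.1‖ ^ 2) / 2

/-- The PARTNER's incoming normal speed `|⟪v_snd⁻, ω⟫|/‖ω‖` along the impact vector of the record (the card
`coboundary-hot-cold-split`'s `partnerNormalSpeed`, verbatim; junk-safe: `0` at `ω = 0`). -/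
def partnerNormalSpeed {N : ℕ} (c : Rec N) : ℝ := |⟪c.preVel.2, c.impactVec⟫_ℝ| / ‖c.impactVec‖

/-- The energy impulse is the absolute value of the signed gain. -/
theorem energyImpulse_eq_abs_gainImpulse {N : ℕ} (c : Rec N) : energyImpulse c = |gainImpulse c| := by
  unfold energyImpulse gainImpulse
  rw [abs_div, abs_two]

/-- A per-record summand family is HOT-GAIN-DOMINATING at level `W` if it is nonnegative and, on the records of its own
particle whose partner arrives with normal speed `> W`, at least the positive part of the gain (instances: the ideators'
`hotSupplyOf M` for `M ≤ W` and `hotDonorGainOf W₀` for `W₀ ≤ W`; every energy-dominating summand, at every `W`). -/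
def IsHotGainDominating (W : ℝ) (F : (N : ℕ) → Fin (N + 1) → Rec N → ℝ) : Prop :=
  (∀ N i c, 0 ≤ F N i c) ∧ ∀ N i (c : Rec N), c.fst = i → W < partnerNormalSpeed c → max (gainImpulse c) 0 ≤ F N i c

/-- Energy-dominating summands are hot-gain-dominating at every level. -/
theorem isHotGainDominating_of_isEnergyDominating {F : (N : ℕ) → Fin (N + 1) → Rec N → ℝ}
    (hF : IsEnergyDominating F) (W : ℝ) : IsHotGainDominating W F := by
  refine ⟨hF.1, fun N i c hi _ => le_trans ?_ (hF.2 N i c hi)⟩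
  rw [energyImpulse_eq_abs_gainImpulse]
  exact max_le (le_abs_self _) (abs_nonneg _)

/-- Monotonicity in the level: domination at level `W` gives domination at every higher level. -/
theorem IsHotGainDominating.mono {W W' : ℝ} {F : (N : ℕ) → Fin (N + 1) → Rec N → ℝ}
    (hF : IsHotGainDominating W F) (hWW' : W ≤ W') : IsHotGainDominating W' F :=
  ⟨hF.1, fun N i c hi hW' => hF.2 N i c hi (hWW'.trans_lt hW')⟩

/-! #### The receiving records of the relay are hot and gain `≥ gRec` -/

section Lattice

variable {Λ : EquilibriumClampedCollisionalWindowLDNegative.Lat} {N : ℕ} {a : Fin (N + 1) ≃ Λ.Slot}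
variable {Φ : HardSphereFlow (Torus.geometry (Fin 3)) Λ.P.ε (N + 1)}

/-- **The receiving sphere of a transfer is hot-supplied and hyperactive**: if `W < clo − u`, its windowed `F`-sum is at
least `gRec` for every `F` hot-gain-dominating at level `W` (receiving record: partner = the carrier, `preVel.2 = W_c`,
impact vector `= n`, `|⟪W_c, n⟫| = |c + ⟪η, n⟫| ≥ c − u ≥ clo − u > W`; gain `= (‖η + cn‖² − ‖η‖²)/2 ≥ clo(clo−2u)/2`). -/
theorem collisionSum_ge_of_hotDominating (hW : Λ.WinOK) (hG : Λ.GainOK) (hε : Λ.P.ε < 1 / 2) {z : Cfg N}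
    (hz : z ∈ Λ.Ev a) (hgood : z ∈ Φ.good) {W : ℝ} {F : Fin (N + 1) → Rec N → ℝ} (hF0 : ∀ p c, 0 ≤ F p c)
    (hFE : ∀ p (c : Rec N), c.fst = p → W < partnerNormalSpeed c → max (gainImpulse c) 0 ≤ F p c)
    (hWlt : W < Λ.P.clo - Λ.P.u)
    {tr : ℕ × (Fin Λ.n × Fin Λ.n) × ℕ} (htr : tr ∈ Λ.transfers a z) :
    gRec Λ.P ≤ Φ.collisionSum (Set.Ioc 0 Λ.w) (F (Λ.sphJ a tr)) z := by
  classical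
  have hΛ := hW.ok
  have hP := hΛ.sep.adm
  rw [collisionSum_window hW hε hz hgood]
  have hnn : ∀ tr' ∈ Λ.transfers a z, 0 ≤
      F (Λ.sphJ a tr) (HardSphereCollisionRecord.ofConfig (Torus.geometry (Fin 3)) Λ.P.ε
          (Λ.cert a z (Λ.ttime a z tr')) (Λ.ttime a z tr') (Λ.sphI a tr') (Λ.sphJ a tr')) +
        F (Λ.sphJ a tr) (HardSphereCollisionRecord.ofConfig (Torus.geometry (Fin 3)) Λ.P.ε
          (Λ.cert a z (Λ.ttime a z tr')) (Λ.ttime a z tr') (Λ.sphJ a tr') (Λ.sphI a tr')) :=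
    fun tr' _ => add_nonneg (hF0 _ _) (hF0 _ _)
  refine le_trans ?_ (Finset.single_le_sum hnn htr)
  -- the receiving record of `tr`
  obtain ⟨hb, hj, hact, -⟩ := mem_transfers.1 htr
  have hD := dataOK_of_mem hΛ hz hact tr.2.1
  have hf := stepFacts hP hD (by omega : tr.2.2 + 1 ≤ Λ.P.K)
  have hn1 : ‖Λ.trN a z tr‖ = 1 := hf.cont.n_unit
  have hε0 : Λ.P.ε ≠ 0 := hP.ε_pos.ne'
  obtain ⟨-, hpj⟩ := preVel_transfer hW hz htr
  obtain ⟨hvi, hvj⟩ := cert_snd_transfer hW hz htr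
  -- the impact vector of the receiving record is the unit normal `n`
  have hsv := sepVec_sph hW hz htr
  have hsv' : (Torus.geometry (Fin 3)).sepVec (Λ.cert a z (Λ.ttime a z tr) (Λ.sphJ a tr)).1
      (Λ.cert a z (Λ.ttime a z tr) (Λ.sphI a tr)).1 = Λ.P.ε • Λ.trN a z tr := by
    have hreg := regular hP hε
    rw [hreg.sepVec_comm _ _ (by rw [hsv, norm_neg, norm_smul, hn1, mul_one, Real.norm_of_nonneg hP.ε_pos.le]),
      hsv, neg_neg]
  set c := Λ.trC a z tr with hc
  set n := Λ.trN a z tr with hn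
  set Wc := Λ.trW a z tr with hWc
  set η := Λ.trη a z tr with hη
  have hcdef : c = ⟪Wc - η, n⟫_ℝ := rfl
  have hcge : Λ.P.clo ≤ c := hf.cont.c_ge
  have hηu : ‖η‖ ≤ Λ.P.u := hD.η_le (tr.2.2 + 1) (by omega) (by omega)
  have hu := hP.u_nn
  have hclo := hP.clo_pos
  have hc0 : 0 ≤ c := hclo.le.trans hcge
  -- partner normal speed of the receiving record
  have hηn : |⟪η, n⟫_ℝ| ≤ Λ.P.u := by
    have h1 := abs_real_inner_le_norm η n
    rw [hn1, mul_one] at h1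
    exact h1.trans hηu
  have hWn : Λ.P.clo - Λ.P.u ≤ |⟪Wc, n⟫_ℝ| := by
    have e : ⟪Wc, n⟫_ℝ = c + ⟪η, n⟫_ℝ := by rw [hcdef, inner_sub_left]; ring
    rw [e]
    have := neg_abs_le (⟪η, n⟫_ℝ)
    have h2 : c + ⟪η, n⟫_ℝ ≤ |c + ⟪η, n⟫_ℝ| := le_abs_self _
    linarith
  have hhot : W < partnerNormalSpeed (HardSphereCollisionRecord.ofConfig (Torus.geometry (Fin 3)) Λ.P.ε
      (Λ.cert a z (Λ.ttime a z tr)) (Λ.ttime a z tr) (Λ.sphJ a tr) (Λ.sphI a tr)) := by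
    unfold partnerNormalSpeed
    rw [HardSphereCollisionRecord.ofConfig_impactVec, hsv', smul_smul, inv_mul_cancel₀ hε0, one_smul, hpj, hn1,
      div_one]
    exact hWlt.trans_le hWn
  -- the gain of the receiver
  have hexp : ‖η + c • n‖ ^ 2 - ‖η‖ ^ 2 = 2 * (c * ⟪η, n⟫_ℝ) + c ^ 2 := by
    rw [norm_add_sq_real, real_inner_smul_right, norm_smul, hn1, mul_one, Real.norm_eq_abs, sq_abs]; ring
  have hin : -Λ.P.u ≤ ⟪η, n⟫_ℝ := by
    have := neg_abs_le (⟪η, n⟫_ℝ); linarith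
  have hin' : c * (-Λ.P.u) ≤ c * ⟪η, n⟫_ℝ := mul_le_mul_of_nonneg_left hin hc0
  have hmono : Λ.P.clo * (Λ.P.clo - 2 * Λ.P.u) ≤ c ^ 2 - 2 * (c * Λ.P.u) := by
    have h := mul_nonneg (sub_nonneg.2 hcge) (by linarith [hG.u_le] : 0 ≤ c + Λ.P.clo - 2 * Λ.P.u)
    nlinarith [h]
  have hB : Λ.P.clo * (Λ.P.clo - 2 * Λ.P.u) ≤ ‖η + c • n‖ ^ 2 - ‖η‖ ^ 2 := by rw [hexp]; linarith
  -- drop the giving record, read the receiving one through the domination hypothesis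
  refine le_trans ?_ (le_add_of_nonneg_left (hF0 _ _))
  refine le_trans ?_ (hFE _ _ (HardSphereCollisionRecord.ofConfig_fst _ _ _ _ _ _) hhot)
  refine le_trans ?_ (le_max_left _ _)
  unfold gainImpulse
  simp only [HardSphereCollisionRecord.ofConfig_postVel, hpj, hvj]
  unfold gRec
  linarith

/-- **The tail sum on a labelled event** (hot version). -/
theorem tailSumH_ge (hW : Λ.WinOK) (hG : Λ.GainOK) (hε : Λ.P.ε < 1 / 2) {z : Cfg N} (hz : z ∈ Λ.Ev a)
    (hgood : z ∈ Φ.good) {W : ℝ} {F : Fin (N + 1) → Rec N → ℝ} (hF0 : ∀ p c, 0 ≤ F p c)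
    (hFE : ∀ p (c : Rec N), c.fst = p → W < partnerNormalSpeed c → max (gainImpulse c) 0 ≤ F p c)
    (hWlt : W < Λ.P.clo - Λ.P.u)
    {κ V : ℝ} (hκ : 0 ≤ κ) (hV : V < κ * gRec Λ.P) {kw : ℕ} (hkK : kw + 1 ≤ Λ.P.K)
    (hkw : (kw : ℝ) * Λ.P.θhi ≤ Λ.w) (hM : 24 * Λ.m ≤ Λ.M) :
    Λ.Tlow kw * (κ * gRec Λ.P) ≤
      ∑ p : Fin (N + 1), Set.indicator {y : ℝ | V < y} (fun y => y) (actF Λ Φ F κ p z) := by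
  classical
  have hΛ := hW.ok
  have hg0 := gRec_nonneg hΛ hG
  have hact0 : ∀ p, 0 ≤ actF Λ Φ F κ p z := by
    intro p
    unfold actF
    refine mul_nonneg hκ ?_
    rw [HardSphereFlow.collisionSum_eq, collisionSum_eq_collisionPairSum]
    exact collisionPairSum_nonneg fun _ _ _ => hF0 _ _
  have htail0 : ∀ p, 0 ≤ Set.indicator {y : ℝ | V < y} (fun y => y) (actF Λ Φ F κ p z) := fun p =>
    Set.indicator_apply_nonneg fun _ => hact0 p
  have hrecv : ∀ tr ∈ Λ.transfers a z,
      κ * gRec Λ.P ≤ Set.indicator {y : ℝ | V < y} (fun y => y) (actF Λ Φ F κ (Λ.sphJ a tr) z) := by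
    intro tr htr
    have h1 : κ * gRec Λ.P ≤ actF Λ Φ F κ (Λ.sphJ a tr) z :=
      mul_le_mul_of_nonneg_left (collisionSum_ge_of_hotDominating hW hG hε hz hgood hF0 hFE hWlt htr) hκ
    rw [Set.indicator_of_mem (show actF Λ Φ F κ (Λ.sphJ a tr) z ∈ {y : ℝ | V < y} from hV.trans_le h1)]
    exact h1
  have hT : Λ.Tlow kw ≤ ((Λ.transfers a z).card : ℝ) := by
    have h1 := card_transfers_ge (a := a) hΛ hz hkK hkw
    have h2 := card_active_ge Λ hΛ hM
    have h1' : ((((Finset.range Λ.Q).filter Λ.Active).card * (Λ.n * Λ.n) * kw : ℕ) : ℝ) ≤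
        (Λ.transfers a z).card := by
      exact_mod_cast h1
    push_cast at h1'
    unfold Lat.Tlow
    have : (0 : ℝ) ≤ (Λ.n : ℝ) * Λ.n * kw := by positivity
    nlinarith
  calc Λ.Tlow kw * (κ * gRec Λ.P) ≤ ((Λ.transfers a z).card : ℝ) * (κ * gRec Λ.P) :=
        mul_le_mul_of_nonneg_right hT (mul_nonneg hκ hg0)
    _ = ∑ _tr ∈ Λ.transfers a z, κ * gRec Λ.P := by rw [Finset.sum_const, nsmul_eq_mul]
    _ ≤ ∑ tr ∈ Λ.transfers a z, Set.indicator {y : ℝ | V < y} (fun y => y) (actF Λ Φ F κ (Λ.sphJ a tr) z) :=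
        Finset.sum_le_sum hrecv
    _ = ∑ p ∈ (Λ.transfers a z).image (Λ.sphJ a),
          Set.indicator {y : ℝ | V < y} (fun y => y) (actF Λ Φ F κ p z) := by
        rw [Finset.sum_image fun tr htr tr' htr' h => sphJ_inj hΛ htr htr' h]
    _ ≤ ∑ p : Fin (N + 1), Set.indicator {y : ℝ | V < y} (fun y => y) (actF Λ Φ F κ p z) :=
        Finset.sum_le_univ_sum_of_nonneg fun p => htail0 p

/-- **Pointwise exponent bound on a labelled event** (hot version). -/
theorem exponentH_ge_tail (hW : Λ.WinOK) (hG : Λ.GainOK) (hε : Λ.P.ε < 1 / 2) (hw0 : 0 < Λ.w) {z : Cfg N}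
    (hz : z ∈ Λ.Ev a) (hgood : z ∈ Φ.good) {W : ℝ} {F : Fin (N + 1) → Rec N → ℝ} (hF0 : ∀ p c, 0 ≤ F p c)
    (hFE : ∀ p (c : Rec N), c.fst = p → W < partnerNormalSpeed c → max (gainImpulse c) 0 ≤ F p c)
    (hWlt : W < Λ.P.clo - Λ.P.u)
    {κ V β B : ℝ} (hκ : 0 ≤ κ) (hV : V < κ * gRec Λ.P) (hβ : 0 ≤ β)
    (hB : 2 * β ≤ B) (hκε : Λ.P.ε ≤ κ * Λ.w) {kw : ℕ} (hkK : kw + 1 ≤ Λ.P.K) (hkw : (kw : ℝ) * Λ.P.θhi ≤ Λ.w)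
    (hM : 24 * Λ.m ≤ Λ.M) :
    Λ.Fmin N kw β 1 ≤ B * ∑ p : Fin (N + 1), Set.indicator {y : ℝ | V < y} (fun y => y) (actF Λ Φ F κ p z) := by
  have hΛ := hW.ok
  have hg0 := gRec_nonneg hΛ hG
  have hS := tailSumH_ge hW hG hε hz hgood hF0 hFE hWlt hκ hV hkK hkw hM
  have hS0 : 0 ≤ ∑ p : Fin (N + 1), Set.indicator {y : ℝ | V < y} (fun y => y) (actF Λ Φ F κ p z) :=
    le_trans (mul_nonneg (by unfold Lat.Tlow; positivity) (mul_nonneg hκ hg0)) hS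
  have hT0 : 0 ≤ Λ.Tlow kw := by unfold Lat.Tlow; positivity
  have hwi : 0 < Λ.w⁻¹ := inv_pos.2 hw0
  have hgain : Λ.w⁻¹ * gainT Λ.P ≤ 2 * (κ * gRec Λ.P) := by
    have h1 : Λ.w⁻¹ * gainT Λ.P ≤ Λ.w⁻¹ * (2 * Λ.P.ε * gRec Λ.P) :=
      mul_le_mul_of_nonneg_left (gainT_le hΛ hG) hwi.le
    have h2 : Λ.w⁻¹ * Λ.P.ε ≤ κ := by
      rw [inv_mul_le_iff₀ hw0]; linarith [hκε]
    calc Λ.w⁻¹ * gainT Λ.P ≤ Λ.w⁻¹ * (2 * Λ.P.ε * gRec Λ.P) := h1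
      _ = 2 * (Λ.w⁻¹ * Λ.P.ε) * gRec Λ.P := by ring
      _ ≤ 2 * κ * gRec Λ.P := by gcongr
      _ = 2 * (κ * gRec Λ.P) := by ring
  have hmain : Λ.w⁻¹ * (Λ.Tlow kw * gainT Λ.P) ≤
      2 * ∑ p : Fin (N + 1), Set.indicator {y : ℝ | V < y} (fun y => y) (actF Λ Φ F κ p z) := by
    calc Λ.w⁻¹ * (Λ.Tlow kw * gainT Λ.P) = Λ.Tlow kw * (Λ.w⁻¹ * gainT Λ.P) := by ring
      _ ≤ Λ.Tlow kw * (2 * (κ * gRec Λ.P)) := mul_le_mul_of_nonneg_left hgain hT0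
      _ = 2 * (Λ.Tlow kw * (κ * gRec Λ.P)) := by ring
      _ ≤ _ := by linarith [hS]
  unfold Lat.Fmin
  simp only [sub_self, abs_zero, zero_mul, mul_zero, sub_zero]
  calc β * (Λ.w⁻¹ * (Λ.Tlow kw * gainT Λ.P))
      ≤ β * (2 * ∑ p : Fin (N + 1), Set.indicator {y : ℝ | V < y} (fun y => y) (actF Λ Φ F κ p z)) :=
        mul_le_mul_of_nonneg_left hmain hβ
    _ = (2 * β) * ∑ p : Fin (N + 1), Set.indicator {y : ℝ | V < y} (fun y => y) (actF Λ Φ F κ p z) := by ring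
    _ ≤ B * ∑ p : Fin (N + 1), Set.indicator {y : ℝ | V < y} (fun y => y) (actF Λ Φ F κ p z) :=
        mul_le_mul_of_nonneg_right hB hS0

end Lattice


section Lattice

variable {Λ : EquilibriumClampedCollisionalWindowLDNegative.Lat} {N : ℕ} {a : Fin (N + 1) ≃ Λ.Slot}
variable {Φ : HardSphereFlow (Torus.geometry (Fin 3)) Λ.P.ε (N + 1)}

/-- **The main lower bound for the exponential moment of the `F`-tail sum** (hot version). -/
theorem lintegralH_tail_ge (hcardN : Fintype.card Λ.Slot = N + 1) (hW : Λ.WinOK) (hG : Λ.GainOK)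
    (hε : Λ.P.ε < 1 / 2) (hr : Λ.P.r < 1 / 2) (hw0 : 0 < Λ.w) {σ : ℝ} (hσ : σ ≤ 1 / 2)
    (hεσ : hsDiameter σ N = Λ.P.ε)
    (hgoodP : localGibbsMeasure σ (fun _ => 1) (fun _ => 0) (fun _ => (1 : ℝ)) N Φ.goodᶜ = 0)
    {W : ℝ} {F : Fin (N + 1) → Rec N → ℝ} (hF0 : ∀ p c, 0 ≤ F p c)
    (hFE : ∀ p (c : Rec N), c.fst = p → W < partnerNormalSpeed c → max (gainImpulse c) 0 ≤ F p c)
    (hWlt : W < Λ.P.clo - Λ.P.u)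
    {κ V β B : ℝ} (hκ : 0 ≤ κ) (hV : V < κ * gRec Λ.P) (hβ : 0 ≤ β) (hB : 2 * β ≤ B) (hκε : Λ.P.ε ≤ κ * Λ.w)
    {kw : ℕ} (hkK : kw + 1 ≤ Λ.P.K) (hkw : (kw : ℝ) * Λ.P.θhi ≤ Λ.w) (hM : 24 * Λ.m ≤ Λ.M) :
    ENNReal.ofReal (((N + 1).factorial : ℝ) * Real.exp (Λ.Fmin N kw β 1) * Λ.evB N) ≤
      ∫⁻ z, ENNReal.ofReal (Real.exp (B * ∑ p : Fin (N + 1),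
          Set.indicator {y : ℝ | V < y} (fun y => y) (actF Λ Φ F κ p z)))
        ∂(localGibbsMeasure σ (fun _ => 1) (fun _ => 0) (fun _ => (1 : ℝ)) N) := by
  classical
  set P := localGibbsMeasure σ (fun _ => 1) (fun _ => 0) (fun _ => (1 : ℝ)) N with hP
  set f : Cfg N → ENNReal := fun z => ENNReal.ofReal (Real.exp (B * ∑ p : Fin (N + 1),
      Set.indicator {y : ℝ | V < y} (fun y => y) (actF Λ Φ F κ p z)))
  set c : ENNReal := ENNReal.ofReal (Real.exp (Λ.Fmin N kw β 1)) with hc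
  have hmeas : ∀ a : Fin (N + 1) ≃ Λ.Slot, MeasurableSet (Λ.Ev a : Set (Cfg N)) := fun a => measurableSet_Ev
  have hdisj : Pairwise (Function.onFun Disjoint fun a : Fin (N + 1) ≃ Λ.Slot => (Λ.Ev a : Set (Cfg N))) :=
    fun a a' h => Ev_disjoint hW h
  have step1 : ∑ a : Fin (N + 1) ≃ Λ.Slot, ∫⁻ z in Λ.Ev a, f z ∂P ≤ ∫⁻ z, f z ∂P := by
    have h := lintegral_iUnion (μ := P) hmeas hdisj f
    rw [tsum_fintype] at h
    rw [← h]
    exact setLIntegral_le_lintegral _ _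
  have step2 : ∀ a : Fin (N + 1) ≃ Λ.Slot, c * P (Λ.Ev a) ≤ ∫⁻ z in Λ.Ev a, f z ∂P := by
    intro a
    have hpt : ∀ z ∈ Λ.Ev a, (Φ.good).indicator (fun _ => c) z ≤ f z := by
      intro z hz
      by_cases hg : z ∈ Φ.good
      · rw [Set.indicator_of_mem hg]
        exact ENNReal.ofReal_le_ofReal (Real.exp_le_exp.2
          (exponentH_ge_tail hW hG hε hw0 hz hg hF0 hFE hWlt hκ hV hβ hB hκε hkK hkw hM))
      · rw [Set.indicator_of_notMem hg]; exact bot_le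
    calc c * P (Λ.Ev a) ≤ c * P (Φ.good ∩ Λ.Ev a) := by
          refine mul_le_mul' le_rfl ?_
          have hsub : (Λ.Ev a : Set (Cfg N)) ⊆ (Φ.good ∩ Λ.Ev a) ∪ Φ.goodᶜ := by
            intro z hz; by_cases hg : z ∈ Φ.good
            · exact Or.inl ⟨hg, hz⟩
            · exact Or.inr hg
          calc P (Λ.Ev a) ≤ P ((Φ.good ∩ Λ.Ev a) ∪ Φ.goodᶜ) := measure_mono hsub
            _ ≤ P (Φ.good ∩ Λ.Ev a) + P Φ.goodᶜ := measure_union_le _ _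
            _ = P (Φ.good ∩ Λ.Ev a) := by rw [hgoodP, add_zero]
      _ = ∫⁻ z in Λ.Ev a, (Φ.good).indicator (fun _ => c) z ∂P := by
          rw [lintegral_indicator_const Φ.measurableSet_good, Measure.restrict_apply Φ.measurableSet_good]
      _ ≤ ∫⁻ z in Λ.Ev a, f z ∂P := setLIntegral_mono' (hmeas a) hpt
  have step3 : ∀ a : Fin (N + 1) ≃ Λ.Slot, c * ENNReal.ofReal (Λ.evB N) ≤ c * P (Λ.Ev a) := fun a =>
    mul_le_mul' le_rfl (measure_Ev_ge (a := a) hW hσ hεσ hr)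
  have hcardE : Fintype.card (Fin (N + 1) ≃ Λ.Slot) = (N + 1).factorial := by
    have e : Fin (N + 1) ≃ Λ.Slot := Fintype.equivOfCardEq (by rw [Fintype.card_fin, hcardN])
    rw [Fintype.card_equiv e, Fintype.card_fin]
  calc ENNReal.ofReal (((N + 1).factorial : ℝ) * Real.exp (Λ.Fmin N kw β 1) * Λ.evB N)
      = ((N + 1).factorial : ENNReal) * (c * ENNReal.ofReal (Λ.evB N)) := by
        rw [ENNReal.ofReal_mul (by positivity), ENNReal.ofReal_mul (by positivity), ENNReal.ofReal_natCast, hc,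
          mul_assoc]
    _ = ∑ _a : Fin (N + 1) ≃ Λ.Slot, c * ENNReal.ofReal (Λ.evB N) := by
        rw [Finset.sum_const, Finset.card_univ, hcardE, nsmul_eq_mul]
    _ ≤ ∑ a : Fin (N + 1) ≃ Λ.Slot, ∫⁻ z in Λ.Ev a, f z ∂P :=
        Finset.sum_le_sum fun a _ => (step3 a).trans (step2 a)
    _ ≤ _ := step1

end Lattice

/-! #### The refutation, for every hot-gain-dominating summand -/

/-- On the witness lattice the relay is HOT: `t < clo − u` (from `(clo − u)² ≥ clo(clo − 2u) = 2·gRec ≥ (9/40)t⁶`). -/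
theorem clo_sub_u_gt {l n t : ℕ} (hl : 2 ≤ l) (ht : 24 * l ^ 2 ≤ t) (hn : 2 ≤ n) :
    (t : ℝ) < (LatW l n t).P.clo - (LatW l n t).P.u := by
  have hn1 : 1 ≤ n := by omega
  have hΛ := LatW.ok hl ht hn1
  have hG := LatW.gainOK hl ht hn1
  have hP := hΛ.sep.adm
  have hu := hP.u_nn
  have hg := gRec_ge (l := l) (n := n) (t := t) hl ht hn
  have ht' : ((24 * l ^ 2 : ℕ) : ℝ) ≤ t := by exact_mod_cast ht
  push_cast at ht'
  have hl2 : (2 : ℝ) ≤ l := by exact_mod_cast hl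
  have ht2 : (96 : ℝ) ≤ t := by nlinarith
  set clo := (LatW l n t).P.clo
  set u := (LatW l n t).P.u
  have hd0 : 0 ≤ clo - u := by linarith [hG.u_le]
  have hsq : (9 / 40 : ℝ) * (t : ℝ) ^ 6 ≤ (clo - u) ^ 2 := by
    unfold TransferActivityTailsNegative.gRec at hg
    nlinarith [sq_nonneg u]
  -- `t² < (9/40) t⁶` for `t ≥ 96`, then take square roots
  have ht6 : (t : ℝ) ^ 2 < (9 / 40 : ℝ) * (t : ℝ) ^ 6 := by
    have h4 : (1 : ℝ) < (9 / 40 : ℝ) * (t : ℝ) ^ 4 := by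
      have : (96 : ℝ) ^ 4 ≤ (t : ℝ) ^ 4 := pow_le_pow_left₀ (by norm_num) ht2 4
      nlinarith
    have : (t : ℝ) ^ 2 * 1 < (t : ℝ) ^ 2 * ((9 / 40 : ℝ) * (t : ℝ) ^ 4) :=
      mul_lt_mul_of_pos_left h4 (by positivity)
    nlinarith
  have hlt : (t : ℝ) ^ 2 < (clo - u) ^ 2 := ht6.trans_le hsq
  exact lt_of_pow_lt_pow_left₀ 2 hd0 hlt

/-- **The exponential-moment strengthening of the equilibrium `F`-activity tails is false for every nonnegative summand
`F` that is hot-gain-dominating at some level `W`** (frozen line-lattice Newton-cradle relay; `a₀ = θ₀ = 1, u₀ = 0`,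
`σ = (4/5)/l²`, `V = max V₀ 1`, `β = 2`, `ε = 1`, `τ = t⁴` with `t > W`, `N + 1 = (l n)³`). -/
theorem expMomentTailsOf_false_of_hot {W : ℝ} {F : (N : ℕ) → Fin (N + 1) → Rec N → ℝ}
    (hF : IsHotGainDominating W F) : ¬ ExpMomentTailsOf F := by
  classical
  intro H
  obtain ⟨hF0, hFE⟩ := hF
  obtain ⟨σ₀, hσ₀, H⟩ := H 1 1 (0 : V3) one_pos one_pos
  obtain ⟨l, hl, hlσ⟩ : ∃ l : ℕ, 2 ≤ l ∧ (4 / 5 : ℝ) / (l : ℝ) ^ 2 < σ₀ := by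
    refine ⟨⌈1 / σ₀⌉₊ + 2, by omega, ?_⟩
    have h1 : 1 / σ₀ ≤ ⌈1 / σ₀⌉₊ := Nat.le_ceil _
    have hl2 : (1 / σ₀ : ℝ) + 2 ≤ ((⌈1 / σ₀⌉₊ + 2 : ℕ) : ℝ) := by push_cast; linarith
    have hpos : 0 < 1 / σ₀ := by positivity
    set L : ℝ := ((⌈1 / σ₀⌉₊ + 2 : ℕ) : ℝ)
    have hL : 1 / σ₀ < L := by linarith
    have hL1 : 1 ≤ L := by linarith
    rw [div_lt_iff₀ (by positivity)]
    have : 1 < σ₀ * L := by rwa [div_lt_iff₀' hσ₀] at hL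
    nlinarith
  set σ : ℝ := (4 / 5) / (l : ℝ) ^ 2 with hσdef
  have hl0 : (0 : ℝ) < l := by exact_mod_cast (show 0 < l by omega)
  have hl2 : (2 : ℝ) ≤ l := by exact_mod_cast hl
  have hσ : 0 < σ := by positivity
  have hσ5 : σ ≤ 1 / 5 := by
    rw [hσdef, div_le_iff₀ (by positivity)]; nlinarith
  have hσ2 : σ < 1 / 2 := by linarith
  specialize H σ hσ hlσ (flowFam hσ hσ2)
  obtain ⟨V₀, hV₀, H⟩ := H
  specialize H (max V₀ 1) (le_max_left _ _) 2 two_pos 1 one_pos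
  obtain ⟨τ₀, hτ₀, H⟩ := H
  -- the choice of `t` (`τ = t⁴`), now also `t > W`
  obtain ⟨t, ht, hτt, hbig, htV, htW⟩ : ∃ t : ℕ, 24 * l ^ 2 ≤ t ∧ τ₀ ≤ (t : ℝ) ^ 4 ∧
      39 * (l : ℝ) ^ 2 * (224 + 6 * l + 40 * 1 * |(1 : ℝ) - 1|) ≤ 1 * t ∧ max V₀ 1 < t ∧ W < t := by
    set X : ℝ := 39 * (l : ℝ) ^ 2 * (224 + 6 * l) with hX
    set S : ℕ := ⌈τ₀⌉₊ + 24 * l ^ 2 + ⌈X⌉₊ + ⌈max V₀ 1⌉₊ + ⌈max W 0⌉₊ + 1 with hS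
    have hSge : ∀ m : ℕ, m + 1 ≤ S → (m : ℝ) + 1 ≤ (S : ℝ) := fun m hm => by exact_mod_cast hm
    refine ⟨S, by omega, ?_, ?_, ?_, ?_⟩
    · have h1 : τ₀ ≤ ⌈τ₀⌉₊ := Nat.le_ceil _
      have h2 := hSge ⌈τ₀⌉₊ (by omega)
      have h3 : (1 : ℝ) ≤ (S : ℝ) := by exact_mod_cast (show 1 ≤ S by omega)
      calc τ₀ ≤ (S : ℝ) := by linarith
        _ = (S : ℝ) ^ 1 := (pow_one _).symm
        _ ≤ _ := pow_le_pow_right₀ h3 (by norm_num)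
    · have h1 : X ≤ ⌈X⌉₊ := Nat.le_ceil _
      have h2 := hSge ⌈X⌉₊ (by omega)
      rw [sub_self, abs_zero, mul_zero, add_zero, one_mul]
      linarith
    · have h1 : max V₀ 1 ≤ ⌈max V₀ 1⌉₊ := Nat.le_ceil _
      have h2 := hSge ⌈max V₀ 1⌉₊ (by omega)
      linarith
    · have h1 : max W 0 ≤ ⌈max W 0⌉₊ := Nat.le_ceil _
      have h2 := hSge ⌈max W 0⌉₊ (by omega)
      have h3 : W ≤ max W 0 := le_max_left _ _
      linarith
  specialize H ((t : ℝ) ^ 4) hτt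
  obtain ⟨N₀, H⟩ := H
  set n : ℕ := N₀ + 18 * t ^ 7 * l ^ 2 + 10 with hn
  have hn2 : 2 ≤ n := by omega
  have hn1 : 1 ≤ n := by omega
  set N : ℕ := (l * n) ^ 3 - 1 with hNdef
  have hln : 1 ≤ l * n := Nat.mul_pos (by omega) (by omega)
  have hN : N + 1 = (l * n) ^ 3 := by
    have : 1 ≤ (l * n) ^ 3 := Nat.one_le_pow _ _ hln; omega
  have hN₀ : N₀ ≤ N := by
    have h1 : l * n ≤ (l * n) ^ 3 := by
      calc l * n = (l * n) ^ 1 := (pow_one _).symm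
        _ ≤ (l * n) ^ 3 := Nat.pow_le_pow_right hln (by norm_num)
    have h2 : n ≤ l * n := Nat.le_mul_of_pos_left n (by omega)
    omega
  have hE := H N hN₀
  set Λ := LatW' l n t with hΛ
  have hΛeq : Λ = LatW l n t := LatW'_eq hl hn1
  have hcard : Fintype.card Λ.Slot = N + 1 := by rw [hΛeq, LatW.card_slot, hN]
  have hchart : 4 * (6 * (t : ℝ) ^ 7 * (l : ℝ) ^ 2 + 4) ≤ (l : ℝ) ^ 3 * n := by
    have hn' : ((18 * t ^ 7 * l ^ 2 + 10 : ℕ) : ℝ) ≤ n := by exact_mod_cast (by omega)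
    push_cast at hn'
    have hl8 : (8 : ℝ) ≤ (l : ℝ) ^ 3 := by
      have := pow_le_pow_left₀ (by norm_num : (0:ℝ) ≤ 2) hl2 3; norm_num at this; exact this
    have h0 : (0 : ℝ) ≤ (t : ℝ) ^ 7 * (l : ℝ) ^ 2 := by positivity
    have h1 : (8 : ℝ) * n ≤ (l : ℝ) ^ 3 * n := mul_le_mul_of_nonneg_right hl8 (by positivity)
    nlinarith
  have hW' : Λ.WinOK := by rw [hΛeq]; exact LatW.winOK hl ht hn1 hchart
  have hG : Λ.GainOK := by rw [hΛeq]; exact LatW.gainOK hl ht hn1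
  obtain ⟨hε12, hr12, -⟩ : Λ.P.ε < 1 / 2 ∧ Λ.P.r < 1 / 2 ∧ (4 / 5 : ℝ) / (l : ℝ) ^ 2 ≤ 1 / 2 := by
    rw [hΛeq]; exact LatW.small_facts hl ht hn1
  have hT := bpar.Tpos hl ht
  have hc := LatW.c_pos (l := l) (n := n) hl hn1
  have hw0 : 0 < Λ.w := by show 0 < cscale l n * ((t : ℝ) ^ 4 * (l : ℝ) ^ 2); positivity
  have hεσ : hsDiameter σ N = Λ.P.ε := rfl
  have hgoodP : localGibbsMeasure σ (fun _ => 1) (fun _ => 0) (fun _ => (1 : ℝ)) N (flowFam hσ hσ2 N).goodᶜ = 0 :=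
    localGibbsMeasure_absolutelyContinuous σ _ _ _ N (flowFam hσ hσ2 N) (flowFam hσ hσ2 N).measure_compl_good
  have hκ : 0 ≤ σ / (t : ℝ) ^ 4 := by positivity
  have hVlt : max V₀ 1 < σ / (t : ℝ) ^ 4 * gRec Λ.P := by
    rw [hΛeq]
    have hg := gRec_ge (l := l) (n := n) (t := t) hl ht hn2
    have ht' : ((24 * l ^ 2 : ℕ) : ℝ) ≤ t := by exact_mod_cast ht
    push_cast at ht'
    have h1 : σ / (t : ℝ) ^ 4 * ((9 / 80 : ℝ) * (t : ℝ) ^ 6) ≤ σ / (t : ℝ) ^ 4 * gRec (LatW l n t).P :=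
      mul_le_mul_of_nonneg_left hg hκ
    have h2 : σ / (t : ℝ) ^ 4 * ((9 / 80 : ℝ) * (t : ℝ) ^ 6) = (9 / 100) * (t : ℝ) ^ 2 / (l : ℝ) ^ 2 := by
      rw [hσdef]; field_simp; ring
    have h3 : (t : ℝ) < (9 / 100) * (t : ℝ) ^ 2 / (l : ℝ) ^ 2 := by
      rw [lt_div_iff₀ (by positivity)]
      nlinarith
    linarith
  have hWlt : W < Λ.P.clo - Λ.P.u := by
    rw [hΛeq]; exact htW.trans (clo_sub_u_gt hl ht hn2)
  have hκε : Λ.P.ε ≤ σ / (t : ℝ) ^ 4 * Λ.w := by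
    rw [hΛeq, hσdef]; exact le_of_eq (ε_eq_κw (n := n) hl ht)
  obtain ⟨-, -, -, w4, w5, -⟩ := bpar.win_facts hl ht
  have hkK : 4 * t ^ 7 * l ^ 2 + 1 ≤ Λ.P.K := by rw [hΛeq]; exact w5
  have hkw : ((4 * t ^ 7 * l ^ 2 : ℕ) : ℝ) * Λ.P.θhi ≤ Λ.w := by
    rw [hΛeq, LatW.P_eq, Params.scale_θhi _ hc.ne', LatW.w_eq]
    calc ((4 * t ^ 7 * l ^ 2 : ℕ) : ℝ) * (cscale l n * (bpar l t).θhi)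
        = cscale l n * (((4 * t ^ 7 * l ^ 2 : ℕ) : ℝ) * (bpar l t).θhi) := by ring
      _ ≤ cscale l n * ((t : ℝ) ^ 4 * (l : ℝ) ^ 2) := mul_le_mul_of_nonneg_left w4 hc.le
  have hM : 24 * Λ.m ≤ Λ.M := by
    show 24 * (6 * t ^ 7 * l ^ 2 + 3) ≤ l ^ 3 * n
    have hl8 : 8 ≤ l ^ 3 := by
      calc 8 = 2 ^ 3 := by norm_num
        _ ≤ l ^ 3 := Nat.pow_le_pow_left hl 3
    have hn' : 18 * t ^ 7 * l ^ 2 + 10 ≤ n := by omega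
    calc 24 * (6 * t ^ 7 * l ^ 2 + 3) = 8 * (18 * t ^ 7 * l ^ 2 + 9) := by ring
      _ ≤ l ^ 3 * n := Nat.mul_le_mul hl8 (by omega)
  have key := lintegralH_tail_ge (Λ := Λ) (Φ := flowFam hσ hσ2 N) hcard hW' hG hε12 hr12 hw0 (by linarith) hεσ
    hgoodP (F := F N) (hF0 N) (hFE N) hWlt (V := max V₀ 1) (β := 1) (B := 2) hκ hVlt zero_le_one (by norm_num) hκε
    hkK hkw hM
  have hfin := LatW.final_ineq hl ht hn2 hN one_pos 1 hbig
  rw [← hΛeq] at hfin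
  have hlt : ENNReal.ofReal (Real.exp (1 * ((N : ℝ) + 1))) <
      ENNReal.ofReal (((N + 1).factorial : ℝ) * Real.exp (Λ.Fmin N (4 * t ^ 7 * l ^ 2) 1 1) * Λ.evB N) := by
    rw [one_mul, ENNReal.ofReal_lt_ofReal_iff (lt_trans (Real.exp_pos _) hfin)]
    exact hfin
  have hw : (t : ℝ) ^ 4 * ((N : ℝ) + 1) ^ (-(1 / 3 : ℝ)) = Λ.w := by
    rw [LatW.w_eq_stmt (t := t) hl hn1 hN, hΛeq]
  rw [localGibbsLaw_eq, hw] at hE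
  exact absurd (lt_of_lt_of_le hlt (key.trans hE)) (lt_irrefl _)

/-! #### Instances: the ideators' hot summands, and the energy-dominating case again -/

/-- Card `coboundary-hot-cold-split`'s HOT SUPPLY at level `M` (verbatim `hotSupplyOf M`: positive part of the gain on the
records of `i` whose partner arrives with NORMAL speed `> M`). -/
def hotSupplySummand (M : ℝ) (N : ℕ) (i : Fin (N + 1)) (c : Rec N) : ℝ :=
  if c.fst = i ∧ M < partnerNormalSpeed c then max (gainImpulse c) 0 else 0

/-- Card `cool-gains-ride-impulse`'s HOT-DONOR GAIN at level `W₀` (verbatim `hotDonorGainOf W₀`: positive part of the gain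
on the records of `i` whose partner arrives with SPEED `> W₀`). -/
def hotDonorGainSummand (W₀ : ℝ) (N : ℕ) (i : Fin (N + 1)) (c : Rec N) : ℝ :=
  if c.fst = i then (if W₀ < ‖c.preVel.2‖ then max 0 ((‖c.postVel.1‖ ^ 2 - ‖c.preVel.1‖ ^ 2) / 2) else 0) else 0

/-- The partner's normal speed is at most its speed (Cauchy–Schwarz; junk-safe at `ω = 0`). -/
theorem partnerNormalSpeed_le_norm {N : ℕ} (c : Rec N) : partnerNormalSpeed c ≤ ‖c.preVel.2‖ := by
  unfold partnerNormalSpeed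
  by_cases h : ‖c.impactVec‖ = 0
  · rw [h, div_zero]; exact norm_nonneg _
  · rw [div_le_iff₀ (lt_of_le_of_ne (norm_nonneg _) (Ne.symm h))]
    exact abs_real_inner_le_norm _ _

/-- The hot supply at level `M` is hot-gain-dominating at level `M`. -/
theorem isHotGainDominating_hotSupplySummand (M : ℝ) : IsHotGainDominating M (hotSupplySummand M) := by
  refine ⟨fun N i c => ?_, fun N i c hi hM => ?_⟩
  · unfold hotSupplySummand; split_ifs
    · exact le_max_right _ _
    · exact le_rfl
  · unfold hotSupplySummand; rw [if_pos ⟨hi, hM⟩]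

/-- The hot-donor gain at level `W₀` is hot-gain-dominating at level `W₀` (normal speed `≤` speed). -/
theorem isHotGainDominating_hotDonorGainSummand (W₀ : ℝ) : IsHotGainDominating W₀ (hotDonorGainSummand W₀) := by
  refine ⟨fun N i c => ?_, fun N i c hi hW => ?_⟩
  · unfold hotDonorGainSummand; split_ifs
    · exact le_max_left _ _
    · exact le_rfl
    · exact le_rfl
  · unfold hotDonorGainSummand
    rw [if_pos hi, if_pos (hW.trans_le (partnerNormalSpeed_le_norm c)), max_comm]
    rfl

/-- **The LD currency of the hot supply is false at every level `M`.** -/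
theorem hotSupplyExpMoment_false (M : ℝ) : ¬ ExpMomentTailsOf (hotSupplySummand M) :=
  expMomentTailsOf_false_of_hot (isHotGainDominating_hotSupplySummand M)

/-- **The LD currency of the hot-donor gain is false at every level `W₀`.** -/
theorem hotDonorGainExpMoment_false (W₀ : ℝ) : ¬ ExpMomentTailsOf (hotDonorGainSummand W₀) :=
  expMomentTailsOf_false_of_hot (isHotGainDominating_hotDonorGainSummand W₀)

/-- The energy-dominating case re-derived from the hot one (level `0`). -/
theorem expMomentTailsOf_false' {F : (N : ℕ) → Fin (N + 1) → Rec N → ℝ} (hF : IsEnergyDominating F) :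
    ¬ ExpMomentTailsOf F :=
  expMomentTailsOf_false_of_hot (isHotGainDominating_of_isEnergyDominating hF 0)


/-! **Currency remark.** `ExpMomentTailsOf F` would give `EquilibriumTailsOf F` by exponential Chebyshev + Jensen
(the dead direction, not formalised); the crux's `L¹` rung survives the relay because the labelled events have total
Gibbs weight `≤ (N+1)!·G(Ev a) ≍ e^{−C(N+1)log(tl)}` while the tail sum on them is only polynomial in `t, l, N`. -/

end LD

/-! ## §4 Kinematics of the energy summand (why boosts and single fast spheres do not bite; what a proof may use)

The record is read off the post-collisional configuration: `postVel = (vᵢ, vⱼ)`, `preVel = reflectVel n (vᵢ, vⱼ)`,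
`n = sepVec xᵢ xⱼ` (`HardSphereCollisionRecord.ofConfig`).  ENERGY IMPULSE = MOMENTUM IMPULSE × NORMAL CENTRE-OF-MASS
SPEED; not Galilean invariant; dominated by impulse × mean speed (the natural line `EAT ⇐ CAT ∧ speed control`, which
the ideators sharpen to PARTNER normal speed / hot supply — positive content, theirs to land). -/

/-- **Energy jump under the elastic reflection law**: `‖v'‖² − ‖v‖² = −⟪v − w, n⟫⟪v + w, n⟫/‖n‖²` for
`(v', w') = reflectVel n (v, w)` (also at the junk value `n = 0`).  [= 16624 Disproof §4, re-proved here] -/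
theorem reflectVel_energy_jump' (n : V3) (p : V3 × V3) :
    ‖(reflectVel n p).1‖ ^ 2 - ‖p.1‖ ^ 2 = -(⟪p.1 - p.2, n⟫_ℝ * ⟪p.1 + p.2, n⟫_ℝ) / ‖n‖ ^ 2 := by
  by_cases hn : n = 0
  · subst hn; simp
  have hn2 : ‖n‖ ^ 2 ≠ 0 := by positivity
  simp only [reflectVel]
  rw [norm_sub_sq_real, real_inner_smul_right, norm_smul, mul_pow, Real.norm_eq_abs, sq_abs, inner_sub_left,
    inner_add_left]
  field_simp
  ring

/-- **Energy ≤ impulse × mean speed** (polarisation): `|‖a‖² − ‖b‖²|/2 ≤ ‖a − b‖ · (‖a‖ + ‖b‖)/2`. -/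
theorem abs_normSq_sub_normSq_half_le (a b : V3) :
    |‖a‖ ^ 2 - ‖b‖ ^ 2| / 2 ≤ ‖a - b‖ * ((‖a‖ + ‖b‖) / 2) := by
  have h : ‖a‖ ^ 2 - ‖b‖ ^ 2 = ⟪a - b, a + b⟫_ℝ := by
    rw [inner_sub_left, inner_add_right, inner_add_right, real_inner_self_eq_norm_sq, real_inner_self_eq_norm_sq,
      real_inner_comm a b]
    ring
  rw [h]
  have h1 : |⟪a - b, a + b⟫_ℝ| ≤ ‖a - b‖ * ‖a + b‖ := abs_real_inner_le_norm _ _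
  have h2 : ‖a + b‖ ≤ ‖a‖ + ‖b‖ := norm_add_le _ _
  have h3 : ‖a - b‖ * ‖a + b‖ ≤ ‖a - b‖ * (‖a‖ + ‖b‖) := mul_le_mul_of_nonneg_left h2 (norm_nonneg _)
  linarith

/-- **Record form**: `energyOf ≤ momentumOf × (‖v⁺‖ + ‖v⁻‖)/2` record by record — so pathwise
`aᵉᵢ ≤ (sup of the speeds of i over the window) · aᵐᵢ`; a speed cap `K` turns CAT into EAT at level `K·V`
(the cap itself is a WINDOW-SUP kinetic tail under the true law: dynamical, cf. SEET for fixed times). -/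
theorem energyOf_le_momentumOf_mul {N : ℕ} (i : Fin (N + 1)) (c : TransferActivityTailsNegative.Rec N) :
    energyOf N i c ≤ momentumOf N i c * ((‖c.postVel.1‖ + ‖c.preVel.1‖) / 2) := by
  unfold energyOf momentumOf
  split_ifs
  · exact abs_normSq_sub_normSq_half_le _ _
  · simp

/-- **Galilean shift of the energy jump**: boosting both velocities by `U` changes `(‖a‖² − ‖b‖²)/2` by `⟪a − b, U⟫`
(the momentum impulse `a − b` is invariant).  At drift `u₀ = U` the energy activity of a record is
`|⟪Δv, V_cm⟫ + ⟪Δv, U⟫|`: its Gibbs mean grows like `|U|`, so NO threshold `V₀` uniform in `u₀` can exist once a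
collision-rate floor in mean is available (§5 `TailsOfUniformThreshold`); the crux is safe (`V₀` after `u₀`). -/
theorem energy_jump_boost (a b U : V3) :
    (‖a + U‖ ^ 2 - ‖b + U‖ ^ 2) / 2 = (‖a‖ ^ 2 - ‖b‖ ^ 2) / 2 + ⟪a - b, U⟫_ℝ := by
  rw [norm_add_sq_real, norm_add_sq_real, inner_sub_left]
  ring

/-- The boosted energy impulse is within `|⟪a − b, U⟫|` of the unboosted one, and at least `|⟪a − b, U⟫|` minus it
(triangle inequality both ways): the quantitative form of "energy activity ≍ |U| × projected momentum activity" for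
large drifts. -/
theorem abs_energy_jump_boost_ge (a b U : V3) :
    |⟪a - b, U⟫_ℝ| - |‖a‖ ^ 2 - ‖b‖ ^ 2| / 2 ≤ |‖a + U‖ ^ 2 - ‖b + U‖ ^ 2| / 2 := by
  have h := energy_jump_boost a b U
  have e1 : |‖a + U‖ ^ 2 - ‖b + U‖ ^ 2| / 2 = |(‖a + U‖ ^ 2 - ‖b + U‖ ^ 2) / 2| := by
    rw [abs_div, abs_two]
  have e2 : |‖a‖ ^ 2 - ‖b‖ ^ 2| / 2 = |(‖a‖ ^ 2 - ‖b‖ ^ 2) / 2| := by rw [abs_div, abs_two]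
  rw [e1, e2, h]
  have := abs_add_le ((‖a‖ ^ 2 - ‖b‖ ^ 2) / 2 + ⟪a - b, U⟫_ℝ) (-((‖a‖ ^ 2 - ‖b‖ ^ 2) / 2))
  rw [abs_neg, add_neg_cancel_comm] at this
  linarith

/-! ## §5 Load-bearing hypotheses and natural strengthenings (typed; verdicts in the docstrings)

All three variants below are STRENGTHENINGS of `TailsOf F` (the `_of_` lemmas), so their (paper) falsity says
only "any proof must use that hypothesis / quantifier order"; none is Lean-closable today — each needs a
collision-rate FLOOR IN MEAN (with an energy weight) for a tagged sphere along the flow from Gibbs data. -/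

/-- **No-threshold variant** (`V₀ = 0`: the MEAN window energy activity vanishes).  FALSE on paper at equilibrium:
by invariance of `G` the mean is `τ`-independent and equals `ε_N ×` (Gibbs mean energy-transfer RATE of a sphere)
`= c·σ³θ₀^{3/2}·g(σ³) > 0` (contact value × Gaussian moment `E|⟪v_rel,n̂⟫|·|⟪V_cm,n̂⟫|`). [= 16624 §5, energy row] -/
def TailsOfNoThreshold' (F : (N : ℕ) → Fin (N + 1) → TransferActivityTailsNegative.Rec N → ℝ) : Prop :=
  ∀ (a₀ θ₀ : T3 → ℝ) (u₀ : T3 → V3), Continuous a₀ → Continuous θ₀ → Continuous u₀ →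
    (∀ x, 0 < a₀ x) → (∀ x, 0 < θ₀ x) → ∃ σ₀ : ℝ, 0 < σ₀ ∧ ∀ σ : ℝ, 0 < σ → σ < σ₀ →
    ∀ (T : ℝ) (ρ θ : ℝ → T3 → ℝ) (u : ℝ → T3 → V3), IsHardSphereEulerSolution σ T ρ u θ →
    ∀ Φ : (N : ℕ) → Flow σ N,
    TendstoHydroFieldsAt (fun N => localGibbsLaw σ a₀ u₀ θ₀ N (Φ N)) Φ ρ u θ 0 →
    ∀ t ∈ Set.Ico 0 T, ∀ ε : ℝ, 0 < ε →
    ∃ τ₀ : ℝ, 0 < τ₀ ∧ ∀ τ : ℝ, τ₀ ≤ τ → ∃ N₀ : ℕ, ∀ N : ℕ, N₀ ≤ N → ∀ s ∈ Set.Icc 0 t,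
      ∫⁻ z, ENNReal.ofReal (((N : ℝ) + 1)⁻¹ * ∑ i : Fin (N + 1),
            (σ / τ * (Φ N).collisionSum (Set.Ioc s (s + τ * ((N : ℝ) + 1) ^ (-(1 / 3 : ℝ))))
              (F N i) z))
        ∂(localGibbsLaw σ a₀ u₀ θ₀ N (Φ N)) ≤ ENNReal.ofReal ε

/-- `y·𝟙{V < y} ≤ y` on `[0, ∞)`. -/
theorem tail_le_self' {V y : ℝ} (hy : 0 ≤ y) : Set.indicator {y : ℝ | V < y} (fun y => y) y ≤ y :=
  Set.indicator_apply_le' (fun _ => le_rfl) (fun _ => hy)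

/-- The no-threshold variant implies the tail statement (tail ≤ mean pointwise for a nonnegative summand). -/
theorem tailsOf_of_noThreshold' {F : (N : ℕ) → Fin (N + 1) → TransferActivityTailsNegative.Rec N → ℝ}
    (hF : ∀ N i c, 0 ≤ F N i c) (h : TailsOfNoThreshold' F) : TailsOf F := by
  intro a₀ θ₀ u₀ ha hθ hu ha0 hθ0
  obtain ⟨σ₀, hσ₀, H⟩ := h a₀ θ₀ u₀ ha hθ hu ha0 hθ0
  refine ⟨σ₀, hσ₀, fun σ hσ hσlt T ρ θ u hE Φ hlim t ht => ⟨1, one_pos, fun V _ ε hε => ?_⟩⟩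
  obtain ⟨τ₀, hτ₀, H⟩ := H σ hσ hσlt T ρ θ u hE Φ hlim t ht ε hε
  refine ⟨τ₀, hτ₀, fun τ hτ => ?_⟩
  obtain ⟨N₀, H⟩ := H τ hτ
  refine ⟨N₀, fun N hN s hs => (lintegral_mono fun z => ?_).trans (H N hN s hs)⟩
  have hκ : 0 ≤ σ / τ := div_nonneg hσ.le (hτ₀.le.trans hτ)
  refine ENNReal.ofReal_le_ofReal (mul_le_mul_of_nonneg_left (Finset.sum_le_sum fun i _ => ?_)
    (by positivity))
  exact tail_le_self' (mul_nonneg hκ (collisionSum_nonneg (Φ N) _ (hF N i) z))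

/-- **All-windows variant** (drop `τ → ∞`: every `τ > 0`).  FALSE on paper: for a window of `≪ 1` mean free times
(`τσ² ≪ 1`) one collision already gives `aᵉ = (σ/τ)|ΔE| ≫ V` with probability `≍ τσ²`, so `E[aᵉ𝟙{aᵉ>V}] ≍ σ³·E|ΔE|`
uniformly in `N` — the long-window limit is load-bearing. [= 16624 §5] -/
def TailsOfAllWindows' (F : (N : ℕ) → Fin (N + 1) → TransferActivityTailsNegative.Rec N → ℝ) : Prop :=
  ∀ (a₀ θ₀ : T3 → ℝ) (u₀ : T3 → V3), Continuous a₀ → Continuous θ₀ → Continuous u₀ →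
    (∀ x, 0 < a₀ x) → (∀ x, 0 < θ₀ x) → ∃ σ₀ : ℝ, 0 < σ₀ ∧ ∀ σ : ℝ, 0 < σ → σ < σ₀ →
    ∀ (T : ℝ) (ρ θ : ℝ → T3 → ℝ) (u : ℝ → T3 → V3), IsHardSphereEulerSolution σ T ρ u θ →
    ∀ Φ : (N : ℕ) → Flow σ N,
    TendstoHydroFieldsAt (fun N => localGibbsLaw σ a₀ u₀ θ₀ N (Φ N)) Φ ρ u θ 0 →
    ∀ t ∈ Set.Ico 0 T, ∃ V₀ : ℝ, 0 < V₀ ∧ ∀ V : ℝ, V₀ ≤ V → ∀ ε : ℝ, 0 < ε →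
    ∀ τ : ℝ, 0 < τ → ∃ N₀ : ℕ, ∀ N : ℕ, N₀ ≤ N → ∀ s ∈ Set.Icc 0 t,
      ∫⁻ z, ENNReal.ofReal (((N : ℝ) + 1)⁻¹ * ∑ i : Fin (N + 1),
          Set.indicator {y : ℝ | V < y} (fun y => y)
            (σ / τ * (Φ N).collisionSum (Set.Ioc s (s + τ * ((N : ℝ) + 1) ^ (-(1 / 3 : ℝ))))
              (F N i) z))
        ∂(localGibbsLaw σ a₀ u₀ θ₀ N (Φ N)) ≤ ENNReal.ofReal ε

/-- The all-windows variant implies the tail statement (take `τ₀ = 1`). -/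
theorem tailsOf_of_allWindows' {F : (N : ℕ) → Fin (N + 1) → TransferActivityTailsNegative.Rec N → ℝ}
    (h : TailsOfAllWindows' F) : TailsOf F := by
  intro a₀ θ₀ u₀ ha hθ hu ha0 hθ0
  obtain ⟨σ₀, hσ₀, H⟩ := h a₀ θ₀ u₀ ha hθ hu ha0 hθ0
  refine ⟨σ₀, hσ₀, fun σ hσ hσlt T ρ θ u hE Φ hlim t ht => ?_⟩
  obtain ⟨V₀, hV₀, H⟩ := H σ hσ hσlt T ρ θ u hE Φ hlim t ht
  refine ⟨V₀, hV₀, fun V hV ε hε => ⟨1, one_pos, fun τ hτ => ?_⟩⟩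
  exact H V hV ε hε τ (one_pos.trans_le hτ)

/-- **Profile-uniform threshold variant** (`∃ V₀` BEFORE the profiles; everything else verbatim).  ENERGY-SPECIFIC
paper verdict: FALSE — at constant drift `u₀ = U` the torus dynamics is the boosted rest dynamics, the energy summand
is `|⟪Δv, V_cm⟫ + ⟪Δv, U⟫|` (`energy_jump_boost`), its Gibbs mean `≍ |U|·E|⟪Δv,Û⟫| → ∞`, so at the fixed level
`V₀` the tail carries almost the whole mean for `|U|` large, uniformly in `τ, N`; the MOMENTUM twin's uniform
variant is Galilean-invariant and plausibly TRUE — the order "`V₀` after `u₀`" is load-bearing for the energy row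
only.  Not Lean-closable today (rate floor in mean).  A strengthening (`tailsOf_of_uniformThreshold`). -/
def TailsOfUniformThreshold (F : (N : ℕ) → Fin (N + 1) → TransferActivityTailsNegative.Rec N → ℝ) : Prop :=
  ∃ V₀ : ℝ, 0 < V₀ ∧ ∀ (a₀ θ₀ : T3 → ℝ) (u₀ : T3 → V3), Continuous a₀ → Continuous θ₀ → Continuous u₀ →
    (∀ x, 0 < a₀ x) → (∀ x, 0 < θ₀ x) → ∃ σ₀ : ℝ, 0 < σ₀ ∧ ∀ σ : ℝ, 0 < σ → σ < σ₀ →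
    ∀ (T : ℝ) (ρ θ : ℝ → T3 → ℝ) (u : ℝ → T3 → V3), IsHardSphereEulerSolution σ T ρ u θ →
    ∀ Φ : (N : ℕ) → Flow σ N,
    TendstoHydroFieldsAt (fun N => localGibbsLaw σ a₀ u₀ θ₀ N (Φ N)) Φ ρ u θ 0 →
    ∀ t ∈ Set.Ico 0 T, ∀ V : ℝ, V₀ ≤ V → ∀ ε : ℝ, 0 < ε →
    ∃ τ₀ : ℝ, 0 < τ₀ ∧ ∀ τ : ℝ, τ₀ ≤ τ → ∃ N₀ : ℕ, ∀ N : ℕ, N₀ ≤ N → ∀ s ∈ Set.Icc 0 t,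
      ∫⁻ z, ENNReal.ofReal (((N : ℝ) + 1)⁻¹ * ∑ i : Fin (N + 1),
          Set.indicator {y : ℝ | V < y} (fun y => y)
            (σ / τ * (Φ N).collisionSum (Set.Ioc s (s + τ * ((N : ℝ) + 1) ^ (-(1 / 3 : ℝ))))
              (F N i) z))
        ∂(localGibbsLaw σ a₀ u₀ θ₀ N (Φ N)) ≤ ENNReal.ofReal ε

/-- The uniform-threshold variant implies the tail statement (use the uniform `V₀` for every profile). -/
theorem tailsOf_of_uniformThreshold {F : (N : ℕ) → Fin (N + 1) → TransferActivityTailsNegative.Rec N → ℝ}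
    (h : TailsOfUniformThreshold F) : TailsOf F := by
  obtain ⟨V₀, hV₀, H⟩ := h
  intro a₀ θ₀ u₀ ha hθ hu ha0 hθ0
  obtain ⟨σ₀, hσ₀, H⟩ := H a₀ θ₀ u₀ ha hθ hu ha0 hθ0
  exact ⟨σ₀, hσ₀, fun σ hσ hσlt T ρ θ u hE Φ hlim t ht => ⟨V₀, hV₀, H σ hσ hσlt T ρ θ u hE Φ hlim t ht⟩⟩

/-- The three energy instances (the variants a counterexample to the CRUX must NOT rely on). -/
theorem crux_of_variants :
    (TailsOfNoThreshold' energyOf ∨ TailsOfAllWindows' energyOf ∨ TailsOfUniformThreshold energyOf) →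
      Summit.AtomisticToContinuum.HydrodynamicLimit.Theses.OneFlightGossipEngine.EnergyActivityTails := by
  rintro (h | h | h)
  · exact energyActivityTails_iff.2 (tailsOf_of_noThreshold' energyOf_nonneg h)
  · exact energyActivityTails_iff.2 (tailsOf_of_allWindows' h)
  · exact energyActivityTails_iff.2 (tailsOf_of_uniformThreshold h)

/-! ## §6 Targets

No line is picked for this crux (`PICKED.md` absent, `stuck_stubs = []`, ideation round 1: cards
`coboundary-hot-cold-split`, `cool-gains-ride-impulse`, `hot-sojourn-gossip-halving`): nothing to attack stub-wise this
cycle.  First checks to run on any future stub: (i) is it a `TailsOf`/`EquilibriumTailsOf` instance (then §2 applies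
and its equilibrium rung is the target; the ideators' `HST(M)`, `HSTin`, `HDGT(W₀)` ARE such instances, dominated by
the crux — `EAT ⇒ HST/HDGT` is proved in their sketches — hence crux-kind, not cheaper in kind); (ii) does it ask for
concentration in LD currency or an exponential moment under `G` (then §3 kills it: `expMomentTailsOf_false` for
every energy-dominating summand, `expMomentTailsOf_false_of_hot` for every hot-gain-dominating one — `transferOf`,
`energyOf`, `hotSupplyOf M`, `hotDonorGainOf W₀`, and anything `≥` one of them); (iii) does
it consume a raw collision COUNT without a cluster-size exclusion (Burago–Ivanov count heavy tail); (iv) does it put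
`V₀`/`W₀`/`M` before `u₀` (Galilean growth, §5). -/

end Summit.AtomisticToContinuum.HydrodynamicLimit.Cruxes.EnergyActivityTails.Disproof

end
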